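import Mathlib.RingTheory.RootsOfUnity.Complex
import Mathlib.RingTheory.Polynomial.Eisenstein.Basic
import Mathlib.Algebra.MvPolynomial.Equiv
import Mathlib.Algebra.MvPolynomial.Division
import Mathlib.Analysis.Complex.Polynomial.Basic
import Literature.RingTheory.KrullDimension.AffineCatenary
import Literature.ModelTheory.Zilber.EACQuadricBases
import Literature.ModelTheory.Zilber.EACRotundityProofs
import HarnessLib

/-!
# Cyclic-cover bases `xₙ^e = P(x′)` of the first open EAC cell: the integer-period test,
# irreducibility, dimension

Context (honest framing first). The first open range of Zilber's Exponential-Algebraic Closedness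
for `ℂ_exp` is the cell `ECCell (d + 1) d` (`dim cl π(V) = n - 1`; open for `n = 3`,
Mantova–Masser 2024 §1 p. 5), split in `EACAperiodicBase` as
`ECCell (d + 1) d ↔ ECCellAperiodic d ∧ ECCellPeriodic d` according to whether the base hypersurface
`B = cl π(V)` has an INTEGER PERIOD (`HasIntegerPeriod`). For GRAPH bases `xₙ = g(x′)` the test is
`hasIntegerPeriod_graphBase_iff`; the problem side (`Summits/Schanuel/…/ZilberEacComplexCyclicCover*`,
`…DoubleCover`, `…Sphere`, `…QuadricCover`) also solves systems over CYCLIC-COVER bases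
`B(e; P) = {x ∈ ℂ^{s+1} : x_{s+1}^e = P(x′)}` (`e ≥ 2`), which are not graphs. This file supplies the
base-level facts needed to place such families in a sub-cell:

* `cyclicCoverBase e P` is Zariski closed (`= Z(X_{s+1}^e - P)`), and for `e = 1` it is the graph base.
* **Integer-period test** (`hasIntegerPeriod_cyclicCoverBase_iff`, `e ≥ 2`, `P ≠ 0`):
  `B(e; P)` has an integer period iff `P` itself has one, i.e. iff `P(x′ + v′) = P(x′)` for some
  `v′ ∈ ℤˢ ∖ 0`; the vertical component of a period is forced to vanish by the elementary
  `eq_zero_of_forall_pow_eq` ("`t ↦ (t + v)^e` constant on the `e`-th roots of some `c ≠ 0` forces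
  `v = 0`", a degree count in `ℂ[T]`).
* **Quadric covers** (`hasIntegerPeriod_cyclicCoverBase_quadPoly_iff`): for
  `P = Σ Mᵢⱼxᵢxⱼ + Σ bᵢxᵢ + c` the periods are the `v′ ∈ ℤˢ ∖ 0` with `(M + Mᵀ)v′ = 0` and
  `b·v′ = 0`; so every cover `x_{s+1}^e = P(x′)` of a quadric with non-degenerate quadratic part —
  spheres, the hyperboloid `t² = z² + w² + 1` of the problem side's Theorem H — is APERIODIC, hence
  (`isRotund_of_not_hasIntegerPeriod`) rotundity and additive freeness of any irreducible `n`-fold with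
  that base are automatic and the family belongs to the rotundity-free sub-cell `ECCellAperiodic s`.
  Linear `P`: periodic iff `Σ rᵢvᵢ = 0` has a nonzero integer solution.
* **Irreducibility** (`irreducible_cyclicCoverPoly`): `X_{s+1}^e - P` is irreducible as soon as `P`
  has a prime factor of multiplicity one (Eisenstein at that prime in `ℂ[x′][T]`), in particular when
  `P` is irreducible; then `I(B) = (X_{s+1}^e - P)` (Nullstellensatz), `B` is an irreducible closed
  hypersurface and `dim B = s` (`Literature.RingTheory.KrullDimension`, principal primes).
* **The family-level certificate** (`polyFibredCover e P A F` =
  `{x_{s+1}^e = P(x′), yⱼ = Aⱼ(x′) + y_{s+1}Fⱼ(y_{s+1}, x′)}`, the cyclic-cover twin of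
  `EACRotundityProofs.polyFibredGraph`): for irreducible `x_{s+1}^e - P` (`e ≥ 2`) and injective
  `τ : Yⱼ ↦ Ãⱼ + U F̃ⱼ, Yₙ ↦ U` the variety is irreducible closed of dimension `s + 1`
  (`ℂ[W] ≅ ℂ[x′, u, x_{s+1}]/(x_{s+1}^e - P)`), meets the torus, has dominant multiplicative projection
  (so is multiplicatively free and rotund), `I(π(W ∩ Gⁿ)) = I(B)`, `dim cl π = s`, and is additively
  free; whence the binders of `ECCell (s+1) s` / `ECCellAperiodic s` / `ECCellPeriodic s`
  (`ecCell[Aperiodic|Periodic]_hypotheses_polyFibredCover`) and the system dictionary. Instances: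
  the problem side's quadric-cover shape verbatim (`quadricCoverVariety`), and the hyperboloid
  3-fold `{x₃² = x₁² + x₂² + 1, y₁ = x₁ + y₃, y₂ = x₂ - y₃}` as a certified member of
  `ECCellAperiodic 2` whose system is `hyperboloid_model_system_solvable`'s, verbatim.
* **Spheres** (`sphereFibredCover r A F` = {Σ_{i ≤ s+1} xᵢ² = r, yⱼ = Aⱼ(x′) + yₙFⱼ(yₙ, x′)}): the
  double cover `x_{s+2}² = r - Σ_{i ≤ s} xᵢ²` is irreducible for every `r` when `s ≥ 1` and for
  `r ≠ 0` when `s = 0` (`irreducible_cyclicCoverPoly_spherePoly`, `irreducible_sumSq_sub_C`; the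
  excluded `x₁² + x₂²` is reducible, `not_irreducible_X_sq_add_X_sq`) and aperiodic (gen 6), so every
  such sphere cover with injective fibre substitution is a certified member of `ECCellAperiodic (s+1)`;
  the problem side's sphere set with Brownawell–Masser datum = graph of `A` is this variety verbatim
  (`sphereBMVariety_addGraph_eq`), and the quadric-cover system dictionary is stated in the form of
  `exists_solution_quadricCover` (`quadricCoverVariety_inter_expGraph_nonempty_iff`).

What this is NOT: no case of EAC is proved here; `ECCell 3 2` and both its sub-cells remain OPEN;
nothing here bears on Schanuel's conjecture (EAC does not imply SC). Everything is elementary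
algebra recorded for bookkeeping of the open cell ("folklore"); the cell and its split are from
Mantova–Masser 2024 §1 (p. 5, "Further remarks") and Aslanyan–Gallinaro 2024 §3.
-/

namespace Literature.ModelTheory.Zilber

open MvPolynomial
open Literature.NumberTheory.Transcendental

universe u

/-! ### A univariate lemma: translation-invariance of the set of `e`-th roots forces the
translation to be trivial -/

section Univariate

/-- **If `t ↦ (t + v)^e` is constant on the `e`-th roots of some `c ≠ 0` (`e ≥ 2`), then `v = 0`.**
Proof: the `e` roots `t₀ζᵏ` are distinct, the polynomial `(T + v)^e - (T^e + (c' - c))` has degree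
`< e` and vanishes at all of them, so it is zero; its `T^{e-1}`-coefficient is `e·v`. [folklore] -/
theorem eq_zero_of_forall_pow_eq {e : ℕ} (he : 2 ≤ e) {c c' v : ℂ} (hc : c ≠ 0)
    (h : ∀ t : ℂ, t ^ e = c → (t + v) ^ e = c') : v = 0 := by
  classical
  have he0 : e ≠ 0 := by omega
  obtain ⟨t₀, ht₀⟩ := IsAlgClosed.exists_pow_nat_eq c (Nat.pos_of_ne_zero he0)
  have ht₀0 : t₀ ≠ 0 := by
    rintro rfl
    exact hc (by rw [← ht₀, zero_pow he0])
  have hprim : IsPrimitiveRoot (Complex.exp (2 * Real.pi * Complex.I / e)) e :=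
    Complex.isPrimitiveRoot_exp e he0
  set ζ : ℂ := Complex.exp (2 * Real.pi * Complex.I / e) with hζ
  set r : Fin e → ℂ := fun k => t₀ * ζ ^ (k : ℕ) with hr
  have hr_inj : Function.Injective r := by
    intro k l hkl
    have h1 : ζ ^ (k : ℕ) = ζ ^ (l : ℕ) := mul_left_cancel₀ ht₀0 hkl
    exact Fin.ext (hprim.pow_inj k.isLt l.isLt h1)
  have hr_pow : ∀ k, r k ^ e = c := by
    intro k
    have hz : (ζ ^ (k : ℕ)) ^ e = 1 := by
      rw [← pow_mul, mul_comm, pow_mul, hprim.pow_eq_one, one_pow]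
    simp only [hr, mul_pow, hz, mul_one, ht₀]
  set p : Polynomial ℂ := (Polynomial.X + Polynomial.C v) ^ e with hp
  set q : Polynomial ℂ := Polynomial.X ^ e + Polynomial.C (c' - c) with hq
  have hpm : p.Monic := (Polynomial.monic_X_add_C v).pow e
  have hqm : q.Monic := Polynomial.monic_X_pow_add_C _ he0
  have hpdeg : p.natDegree = e := by
    rw [hp, (Polynomial.monic_X_add_C v).natDegree_pow, Polynomial.natDegree_X_add_C, mul_one]
  have hqdeg : q.natDegree = e := Polynomial.natDegree_X_pow_add_C
  have hdeg : p.degree = q.degree := by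
    rw [Polynomial.degree_eq_natDegree hpm.ne_zero, Polynomial.degree_eq_natDegree hqm.ne_zero,
      hpdeg, hqdeg]
  have hlc : p.leadingCoeff = q.leadingCoeff := by rw [hpm.leadingCoeff, hqm.leadingCoeff]
  have hlt : (p - q).natDegree < Fintype.card (Fin e) := by
    rw [Fintype.card_fin]
    by_cases h0 : p - q = 0
    · rw [h0, Polynomial.natDegree_zero]
      exact Nat.pos_of_ne_zero he0
    · rw [Polynomial.natDegree_lt_iff_degree_lt h0]
      have := Polynomial.degree_sub_lt hdeg hpm.ne_zero hlc
      rwa [Polynomial.degree_eq_natDegree hpm.ne_zero, hpdeg] at this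
  have heval : ∀ k, (p - q).eval (r k) = 0 := by
    intro k
    have h1 := h (r k) (hr_pow k)
    simp only [hp, hq, Polynomial.eval_sub, Polynomial.eval_pow, Polynomial.eval_add,
      Polynomial.eval_X, Polynomial.eval_C, h1, hr_pow k]
    ring
  have hpq : p - q = 0 :=
    Polynomial.eq_zero_of_natDegree_lt_card_of_eval_eq_zero (p - q) hr_inj heval hlt
  have hch : (e.choose (e - 1) : ℂ) = e := by
    rw [← Nat.choose_symm (Nat.sub_le e 1), show e - (e - 1) = 1 by omega, Nat.choose_one_right]
  have hpc : p.coeff (e - 1) = v * e := by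
    rw [hp, Polynomial.coeff_X_add_C_pow, show e - (e - 1) = 1 by omega, pow_one, hch]
  have hqc : q.coeff (e - 1) = 0 := by
    rw [hq, Polynomial.coeff_add, Polynomial.coeff_X_pow, if_neg (by omega), Polynomial.coeff_C,
      if_neg (by omega), add_zero]
  have hpq' : p = q := sub_eq_zero.1 hpq
  rw [hpq', hqc] at hpc
  have hne : (e : ℂ) ≠ 0 := Nat.cast_ne_zero.2 he0
  exact (mul_eq_zero.1 hpc.symm).resolve_right hne

end Univariate

/-! ### Cyclic-cover bases -/

section CyclicCover

variable {s : ℕ}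

/-- **Cyclic-cover base** `B(e; P) = {x ∈ ℂ^{s+1} : x_{s+1}^e = P(x₁, …, x_s)}` — the `e`-fold
cover of affine `s`-space branched along `P = 0`; the base of the problem side's cyclic-cover,
double-cover, sphere and hyperboloid families. [folklore] -/
def cyclicCoverBase (e : ℕ) (P : MvPolynomial (Fin s) ℂ) : Set (Fin (s + 1) → ℂ) :=
  {x | x (Fin.last s) ^ e = eval (fun i => x (Fin.castSucc i)) P}

/-- Its equation `X_{s+1}^e - P(X′) ∈ ℂ[X₁, …, X_{s+1}]`. [folklore] -/
noncomputable def cyclicCoverPoly (e : ℕ) (P : MvPolynomial (Fin s) ℂ) :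
    MvPolynomial (Fin (s + 1)) ℂ :=
  X (Fin.last s) ^ e - rename Fin.castSucc P

/-- Membership, unfolded. [folklore] -/
theorem mem_cyclicCoverBase_iff (e : ℕ) (P : MvPolynomial (Fin s) ℂ) (x : Fin (s + 1) → ℂ) :
    x ∈ cyclicCoverBase e P ↔ x (Fin.last s) ^ e = eval (fun i => x (Fin.castSucc i)) P :=
  Iff.rfl

/-- Points in `(x′, t)` coordinates. [folklore] -/
theorem snoc_mem_cyclicCoverBase_iff (e : ℕ) (P : MvPolynomial (Fin s) ℂ) (x' : Fin s → ℂ)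
    (t : ℂ) : (Fin.snoc x' t : Fin (s + 1) → ℂ) ∈ cyclicCoverBase e P ↔ t ^ e = eval x' P := by
  simp only [mem_cyclicCoverBase_iff, Fin.snoc_last, Fin.snoc_castSucc]

/-- `B(e; P) = Z(X_{s+1}^e - P)`. [folklore] -/
theorem cyclicCoverBase_eq_zeroLocus (e : ℕ) (P : MvPolynomial (Fin s) ℂ) :
    cyclicCoverBase e P = zeroLocus ℂ (Ideal.span {cyclicCoverPoly e P}) := by
  ext x
  rw [mem_zeroLocus_span_singleton_iff, mem_cyclicCoverBase_iff, cyclicCoverPoly, map_sub, map_pow,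
    aeval_X, aeval_rename, sub_eq_zero]
  exact Iff.rfl

/-- Cyclic-cover bases are Zariski closed. [folklore] -/
theorem isZariskiClosed_cyclicCoverBase (e : ℕ) (P : MvPolynomial (Fin s) ℂ) :
    IsZariskiClosed ℂ (cyclicCoverBase e P) :=
  ⟨_, cyclicCoverBase_eq_zeroLocus e P⟩

/-- For `e = 1` the "cover" is the graph base `x_{s+1} = P(x′)` of `EACAperiodicBase`. [folklore] -/
theorem cyclicCoverBase_one (P : MvPolynomial (Fin s) ℂ) : cyclicCoverBase 1 P = graphBase P := by
  ext x
  simp only [mem_cyclicCoverBase_iff, pow_one, graphBase, Set.mem_setOf_eq]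

/-- The fibre over every `x′` is nonempty (`e > 0`): `B(e; P)` surjects onto affine `s`-space.
[folklore] -/
theorem exists_snoc_mem_cyclicCoverBase {e : ℕ} (he : 0 < e) (P : MvPolynomial (Fin s) ℂ)
    (x' : Fin s → ℂ) : ∃ t : ℂ, (Fin.snoc x' t : Fin (s + 1) → ℂ) ∈ cyclicCoverBase e P := by
  obtain ⟨t, ht⟩ := IsAlgClosed.exists_pow_nat_eq (eval x' P) he
  exact ⟨t, (snoc_mem_cyclicCoverBase_iff e P x' t).2 ht⟩

/-- `p(x + w) = p(x)` for all `x` iff `transl w p = p`. [folklore] -/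
theorem transl_eq_self_iff_forall_eval {F : Type u} [Field F] [Infinite F] {ι : Type*} (w : ι → F)
    (p : MvPolynomial ι F) : transl w p = p ↔ ∀ x, eval (x + w) p = eval x p := by
  constructor
  · intro h x
    rw [← eval_transl, h]
  · intro h
    apply MvPolynomial.funext
    intro x
    rw [eval_transl, h]

/-- **Integer-period test for cyclic-cover bases** (`e ≥ 2`, `P ≠ 0`): `B(e; P)` has an integer
period iff `P` has one — `P(x′ + v′) = P(x′)` identically for some `v′ ∈ ℤˢ ∖ 0` (then
`(v′, 0)` is a period of `B`). The converse direction: if `(v′, v_{s+1})` is a period then over a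
point `x′` with `P(x′) ≠ 0` the map `t ↦ t + v_{s+1}` sends the `e` distinct roots of `T^e = P(x′)`
to roots of `T^e = P(x′ + v′)`, which forces `v_{s+1} = 0` (`eq_zero_of_forall_pow_eq`) and then
`P(x′ + v′) = P(x′)` everywhere. (For `P = 0` the set `{x_{s+1}^e = 0}` is the hyperplane
`x_{s+1} = 0`, which is periodic; for `e = 1` use `hasIntegerPeriod_graphBase_iff`.) [folklore] -/
theorem hasIntegerPeriod_cyclicCoverBase_iff {e : ℕ} (he : 2 ≤ e) {P : MvPolynomial (Fin s) ℂ}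
    (hP : P ≠ 0) :
    HasIntegerPeriod ℂ (cyclicCoverBase e P) ↔
      ∃ v : Fin s → ℤ, v ≠ 0 ∧ transl (fun i => (v i : ℂ)) P = P := by
  have he0 : 0 < e := by omega
  rw [hasIntegerPeriod_iff_forall_mem_zeroLocus]
  simp only [mem_zeroLocus_vanishingIdeal_iff_of_isZariskiClosed (isZariskiClosed_cyclicCoverBase e P)]
  constructor
  · rintro ⟨w, hw, h⟩
    have hmem : ∀ (x' : Fin s → ℂ) (t : ℂ), t ^ e = eval x' P →
        (t + (w (Fin.last s) : ℂ)) ^ e = eval (fun i => x' i + (w (Fin.castSucc i) : ℂ)) P := by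
      intro x' t ht
      have hx := h _ ((snoc_mem_cyclicCoverBase_iff e P x' t).2 ht)
      rw [mem_cyclicCoverBase_iff] at hx
      simpa only [Pi.add_apply, Fin.snoc_last, Fin.snoc_castSucc] using hx
    obtain ⟨x₀, hx₀⟩ : ∃ x₀ : Fin s → ℂ, eval x₀ P ≠ 0 := by
      by_contra hcon
      simp only [not_exists, not_not] at hcon
      exact hP (MvPolynomial.funext fun x => by rw [hcon x, map_zero])
    have hlast : (w (Fin.last s) : ℂ) = 0 :=
      eq_zero_of_forall_pow_eq he hx₀ fun t ht => hmem x₀ t ht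
    have hlastZ : w (Fin.last s) = 0 := by exact_mod_cast hlast
    refine ⟨fun i => w (Fin.castSucc i), ?_, ?_⟩
    · intro h0
      apply hw
      funext i
      refine Fin.lastCases hlastZ (fun j => ?_) i
      exact congrFun h0 j
    · rw [transl_eq_self_iff_forall_eval]
      intro x'
      obtain ⟨t, ht⟩ := IsAlgClosed.exists_pow_nat_eq (eval x' P) he0
      have h1 := hmem x' t ht
      rw [hlast, add_zero, ht] at h1
      show eval (fun i => x' i + (w (Fin.castSucc i) : ℂ)) P = eval x' P
      exact h1.symm
  · rintro ⟨v, hv, hvP⟩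
    refine ⟨Fin.snoc v 0, ?_, ?_⟩
    · intro h0
      apply hv
      funext j
      have := congrFun h0 (Fin.castSucc j)
      simpa only [Fin.snoc_castSucc, Pi.zero_apply] using this
    · intro x hx
      rw [mem_cyclicCoverBase_iff] at hx ⊢
      simp only [Pi.add_apply, Fin.snoc_last, Fin.snoc_castSucc, Int.cast_zero, add_zero]
      rw [hx]
      have key := (transl_eq_self_iff_forall_eval _ P).1 hvP fun i => x (Fin.castSucc i)
      rw [← key]
      rfl

/-- Negative form: `B(e; P)` (`e ≥ 2`, `P ≠ 0`) is APERIODIC iff `P` has no integer period. Over an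
aperiodic base, rotundity and additive freeness of an irreducible `n`-fold are automatic
(`isRotund_of_not_hasIntegerPeriod`, `isAddFree_of_not_hasIntegerPeriod`), so such families live in
the rotundity-free sub-cell `ECCellAperiodic s`. [folklore] -/
theorem not_hasIntegerPeriod_cyclicCoverBase_iff {e : ℕ} (he : 2 ≤ e) {P : MvPolynomial (Fin s) ℂ}
    (hP : P ≠ 0) :
    ¬ HasIntegerPeriod ℂ (cyclicCoverBase e P) ↔
      ∀ v : Fin s → ℤ, v ≠ 0 → transl (fun i => (v i : ℂ)) P ≠ P := by
  rw [hasIntegerPeriod_cyclicCoverBase_iff he hP]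
  simp only [not_exists, not_and]

end CyclicCover

/-! ### Quadric and linear branch loci -/

section QuadricCover

variable {F : Type u} [Field F] {s : ℕ}

/-- A quadric polynomial is nonzero as soon as its function is nonzero somewhere. [folklore] -/
theorem quadPoly_ne_zero_of_quadFun_ne_zero {M : Matrix (Fin s) (Fin s) F} {b : Fin s → F} {c : F}
    (x : Fin s → F) (hx : quadFun M b c x ≠ 0) : quadPoly M b c ≠ 0 := by
  intro h
  apply hx
  rw [← eval_quadPoly, h, map_zero]

/-- **Translation-invariant quadrics**: `q(x + w) = q(x)` identically iff `(M + Mᵀ)w = 0` and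
`b·w = 0` (then also `wᵀMw = 0`). Compare `hasIntegerPeriod_graphBase_quadPoly_iff`, where the
graph `x_{s+1} = q` allows the extra freedom `b·w = w_{s+1}`. [folklore] -/
theorem transl_quadPoly_eq_self_iff [CharZero F] (M : Matrix (Fin s) (Fin s) F) (b : Fin s → F)
    (c : F) (w : Fin s → F) :
    transl w (quadPoly M b c) = quadPoly M b c ↔
      (∀ i, ∑ j, (M i j + M j i) * w j = 0) ∧ ∑ i, b i * w i = 0 := by
  classical
  haveI : Infinite F := Infinite.of_injective _ Nat.cast_injective
  rw [transl_eq_self_iff_forall_eval]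
  simp only [eval_quadPoly, quadFun_add]
  have hQ : (∀ i, ∑ j, (M i j + M j i) * w j = 0) → ∑ i, ∑ j, M i j * w i * w j = 0 := by
    intro hk
    have h2 := sum_mul_symm_apply_eq_two_mul M w
    simp only [hk, mul_zero, Finset.sum_const_zero] at h2
    exact (mul_eq_zero.1 h2.symm).resolve_left two_ne_zero
  have step : (∀ x : Fin s → F, quadFun M b c x + ∑ i, x i * (∑ j, (M i j + M j i) * w j) +
        (∑ i, ∑ j, M i j * w i * w j + ∑ i, b i * w i) = quadFun M b c x) ↔
      ∀ x : Fin s → F, ∑ i, x i * (∑ j, (M i j + M j i) * w j) +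
        (∑ i, ∑ j, M i j * w i * w j + ∑ i, b i * w i) = 0 :=
    forall_congr' fun x => by rw [add_assoc, add_eq_left]
  rw [step]
  constructor
  · intro h
    have h0 := h 0
    simp only [Pi.zero_apply, zero_mul, Finset.sum_const_zero, zero_add] at h0
    have hk : ∀ i, ∑ j, (M i j + M j i) * w j = 0 := by
      intro k
      have h1 := h (Pi.single k 1)
      rw [sum_single_one_mul, h0, add_zero] at h1
      exact h1
    refine ⟨hk, ?_⟩
    rwa [hQ hk, zero_add] at h0
  · rintro ⟨hk, hL⟩ x
    simp only [hk, mul_zero, Finset.sum_const_zero, zero_add, hQ hk, hL]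

/-- **Integer-period test for quadric covers** `x_{s+1}^e = Σ Mᵢⱼxᵢxⱼ + Σ bᵢxᵢ + c` (`e ≥ 2`, the
quadric polynomial nonzero): periodic iff some `v′ ∈ ℤˢ ∖ 0` has `(M + Mᵀ)v′ = 0` and `b·v′ = 0`.
[folklore] -/
theorem hasIntegerPeriod_cyclicCoverBase_quadPoly_iff {e : ℕ} (he : 2 ≤ e)
    (M : Matrix (Fin s) (Fin s) ℂ) (b : Fin s → ℂ) (c : ℂ) (hq : quadPoly M b c ≠ 0) :
    HasIntegerPeriod ℂ (cyclicCoverBase e (quadPoly M b c)) ↔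
      ∃ v : Fin s → ℤ, v ≠ 0 ∧ (∀ i, ∑ j, (M i j + M j i) * (v j : ℂ) = 0) ∧
        ∑ i, b i * (v i : ℂ) = 0 := by
  rw [hasIntegerPeriod_cyclicCoverBase_iff he hq]
  exact exists_congr fun v => and_congr_right fun _ => transl_quadPoly_eq_self_iff M b c _

/-- **Non-degenerate quadratic part ⇒ aperiodic**: if `det (M + Mᵀ) ≠ 0` then every cyclic cover
`x_{s+1}^e = Σ Mᵢⱼxᵢxⱼ + Σ bᵢxᵢ + c` (`e ≥ 2`) has no integer period (spheres, hyperboloids, the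
Mantova–Masser form `x₁² - x₂²` as a branch locus, …). [folklore] -/
theorem not_hasIntegerPeriod_cyclicCoverBase_quadPoly_of_det_ne_zero {e : ℕ} (he : 2 ≤ e)
    (M : Matrix (Fin s) (Fin s) ℂ) (b : Fin s → ℂ) (c : ℂ) (hq : quadPoly M b c ≠ 0)
    (hdet : (M + M.transpose).det ≠ 0) :
    ¬ HasIntegerPeriod ℂ (cyclicCoverBase e (quadPoly M b c)) := by
  classical
  rw [hasIntegerPeriod_cyclicCoverBase_quadPoly_iff he M b c hq]
  rintro ⟨v, hv, hk, -⟩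
  apply hdet
  rw [← Matrix.exists_mulVec_eq_zero_iff]
  refine ⟨fun j => (v j : ℂ), ?_, ?_⟩
  · intro h0
    apply hv
    funext j
    have hj := congrFun h0 j
    simp only [Pi.zero_apply, Int.cast_eq_zero] at hj
    rw [hj, Pi.zero_apply]
  · funext i
    have hi := hk i
    simpa [Matrix.mulVec, dotProduct, Matrix.add_apply, Matrix.transpose_apply] using hi

/-- **Linear branch locus**: `transl w (Σ rᵢXᵢ + c) = Σ rᵢXᵢ + c` iff `Σ rᵢwᵢ = 0`. [folklore] -/
theorem transl_linear_eq_self_iff [CharZero F] (r : Fin s → F) (c : F) (w : Fin s → F) :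
    transl w (∑ i, C (r i) * X i + C c) = ∑ i, C (r i) * X i + C c ↔ ∑ i, r i * w i = 0 := by
  haveI : Infinite F := Infinite.of_injective _ Nat.cast_injective
  rw [transl_eq_self_iff_forall_eval]
  simp only [map_add, map_sum, map_mul, eval_C, eval_X, Pi.add_apply, mul_add,
    Finset.sum_add_distrib]
  constructor
  · intro h
    have h0 := h 0
    simpa using h0
  · intro h x
    rw [h, add_zero]

/-- **Cyclic covers of a hyperplane arrangement direction**: `x_{s+1}^e = Σ rᵢxᵢ + c` (`e ≥ 2`,
not all of `r, c` zero) is periodic iff `Σ rᵢvᵢ = 0` for some `v ∈ ℤˢ ∖ 0` — always the case for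
`s ≥ 2` and `r ∈ ℚˢ`, never for `s = 1`, `r₁ ≠ 0`. [folklore] -/
theorem hasIntegerPeriod_cyclicCoverBase_linear_iff {e : ℕ} (he : 2 ≤ e) (r : Fin s → ℂ) (c : ℂ)
    (hrc : (∑ i, C (r i) * X i + C c : MvPolynomial (Fin s) ℂ) ≠ 0) :
    HasIntegerPeriod ℂ (cyclicCoverBase e (∑ i, C (r i) * X i + C c)) ↔
      ∃ v : Fin s → ℤ, v ≠ 0 ∧ ∑ i, r i * (v i : ℂ) = 0 := by
  rw [hasIntegerPeriod_cyclicCoverBase_iff he hrc]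
  exact exists_congr fun v => and_congr_right fun _ => transl_linear_eq_self_iff r c _

end QuadricCover

/-! ### Irreducibility, vanishing ideal, dimension -/

section Irreducible

variable {s : ℕ}

/-- `ℂ[X₁, …, X_{s+1}] ≃ ℂ[X₁, …, X_s][T]`, the LAST variable becoming `T`. [folklore] -/
noncomputable def lastVarEquiv (s : ℕ) :
    MvPolynomial (Fin (s + 1)) ℂ ≃ₐ[ℂ] Polynomial (MvPolynomial (Fin s) ℂ) :=
  (renameEquiv ℂ finSuccEquivLast).trans (optionEquivLeft ℂ (Fin s))

/-- `X_{s+1} ↦ T`. [folklore] -/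
@[simp] theorem lastVarEquiv_X_last : lastVarEquiv s (X (Fin.last s)) = Polynomial.X := by
  simp [lastVarEquiv, finSuccEquivLast_last]

/-- `Xᵢ ↦ Xᵢ` (a constant of `ℂ[x′][T]`) for `i ≤ s`. [folklore] -/
@[simp] theorem lastVarEquiv_X_castSucc (i : Fin s) :
    lastVarEquiv s (X (Fin.castSucc i)) = Polynomial.C (X i) := by
  simp [lastVarEquiv, finSuccEquivLast_castSucc]

/-- A polynomial in `x′` becomes a constant of `ℂ[x′][T]`. [folklore] -/
theorem lastVarEquiv_rename_castSucc (P : MvPolynomial (Fin s) ℂ) :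
    lastVarEquiv s (rename Fin.castSucc P) = Polynomial.C P := by
  induction P using MvPolynomial.induction_on with
  | C a => simp [lastVarEquiv]
  | add p q hp hq => simp only [map_add, hp, hq]
  | mul_X p i hp => simp only [map_mul, hp, rename_X, lastVarEquiv_X_castSucc]

/-- `X_{s+1}^e - P ↦ T^e - P`. [folklore] -/
theorem lastVarEquiv_cyclicCoverPoly (e : ℕ) (P : MvPolynomial (Fin s) ℂ) :
    lastVarEquiv s (cyclicCoverPoly e P) = Polynomial.X ^ e - Polynomial.C P := by
  simp only [cyclicCoverPoly, map_sub, map_pow, lastVarEquiv_X_last, lastVarEquiv_rename_castSucc]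

/-- **Eisenstein**: `T^e - a` is irreducible over a domain `R` when `a` has a prime factor `π` of
multiplicity one (`π ∣ a`, `π² ∤ a`), `e ≥ 1`. [folklore] -/
theorem irreducible_X_pow_sub_C {R : Type u} [CommRing R] [IsDomain R] {e : ℕ} (he : 0 < e)
    {π a : R} (hπ : Prime π) (hdvd : π ∣ a) (hndvd : ¬ π ^ 2 ∣ a) :
    Irreducible (Polynomial.X ^ e - Polynomial.C a : Polynomial R) := by
  classical
  have hrw : (Polynomial.X ^ e - Polynomial.C a : Polynomial R) =
      Polynomial.X ^ e + Polynomial.C (-a) := by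
    rw [Polynomial.C_neg, sub_eq_add_neg]
  have hmonic : (Polynomial.X ^ e - Polynomial.C a : Polynomial R).Monic := by
    rw [hrw]
    exact Polynomial.monic_X_pow_add_C (-a) he.ne'
  have hdeg : (Polynomial.X ^ e - Polynomial.C a : Polynomial R).natDegree = e := by
    rw [hrw]
    exact Polynomial.natDegree_X_pow_add_C
  have hprime : (Ideal.span {π}).IsPrime := (Ideal.span_singleton_prime hπ.ne_zero).2 hπ
  refine Polynomial.IsEisensteinAt.irreducible (𝓟 := Ideal.span {π}) ⟨?_, ?_, ?_⟩ hprime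
    hmonic.isPrimitive (by rw [hdeg]; exact he)
  · rw [hmonic.leadingCoeff, Ideal.mem_span_singleton]
    exact fun h1 => hπ.not_unit (isUnit_of_dvd_one h1)
  · intro n hn
    rw [hdeg] at hn
    rw [Polynomial.coeff_sub, Polynomial.coeff_X_pow, if_neg hn.ne, Polynomial.coeff_C, zero_sub,
      Ideal.mem_span_singleton]
    split_ifs
    · exact (dvd_neg).2 hdvd
    · rw [neg_zero]
      exact dvd_zero π
  · rw [Polynomial.coeff_sub, Polynomial.coeff_X_pow, if_neg (by omega), Polynomial.coeff_C,
      if_pos rfl, zero_sub, Ideal.span_singleton_pow, Ideal.mem_span_singleton, dvd_neg]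
    exact hndvd

/-- **Irreducible cyclic covers**: `X_{s+1}^e - P(X′)` is irreducible in `ℂ[X₁, …, X_{s+1}]` when
`P` has a prime factor of multiplicity one (`e ≥ 1`). [folklore] -/
theorem irreducible_cyclicCoverPoly {e : ℕ} (he : 0 < e) {P π : MvPolynomial (Fin s) ℂ}
    (hπ : Prime π) (hdvd : π ∣ P) (hndvd : ¬ π ^ 2 ∣ P) : Irreducible (cyclicCoverPoly e P) := by
  have h := irreducible_X_pow_sub_C he hπ hdvd hndvd
  rw [← lastVarEquiv_cyclicCoverPoly] at h
  exact (MulEquiv.irreducible_iff (lastVarEquiv s)).1 h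

/-- In particular for `P` irreducible (e.g. `P = X₁`, or a non-degenerate quadric in `≥ 3`
variables). [folklore] -/
theorem irreducible_cyclicCoverPoly_of_irreducible {e : ℕ} (he : 0 < e)
    {P : MvPolynomial (Fin s) ℂ} (hP : Irreducible P) : Irreducible (cyclicCoverPoly e P) := by
  refine irreducible_cyclicCoverPoly he hP.prime dvd_rfl fun h2 => ?_
  obtain ⟨u, hu⟩ := h2
  have h1 : P * 1 = P * (P * u) := by rw [mul_one, ← mul_assoc, ← pow_two]; exact hu
  have h3 : (1 : MvPolynomial (Fin s) ℂ) = P * u := mul_left_cancel₀ hP.ne_zero h1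
  exact hP.not_isUnit (isUnit_iff_exists_inv.2 ⟨u, h3.symm⟩)

/-- **Vanishing ideal** (Nullstellensatz): for irreducible `X_{s+1}^e - P`,
`I(B(e; P)) = (X_{s+1}^e - P)`. [folklore] -/
theorem vanishingIdeal_cyclicCoverBase {e : ℕ} {P : MvPolynomial (Fin s) ℂ}
    (hirr : Irreducible (cyclicCoverPoly e P)) :
    vanishingIdeal ℂ (cyclicCoverBase e P) = Ideal.span {cyclicCoverPoly e P} := by
  haveI : (Ideal.span {cyclicCoverPoly e P}).IsPrime :=
    (Ideal.span_singleton_prime hirr.ne_zero).2 hirr.prime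
  rw [cyclicCoverBase_eq_zeroLocus, MvPolynomial.vanishingIdeal_zeroLocus_eq_radical]
  exact Ideal.IsPrime.radical ‹_›

/-- **Irreducible closed hypersurface.** [folklore] -/
theorem isIrreducibleClosed_cyclicCoverBase {e : ℕ} {P : MvPolynomial (Fin s) ℂ}
    (hirr : Irreducible (cyclicCoverPoly e P)) : IsIrreducibleClosed ℂ (cyclicCoverBase e P) := by
  refine ⟨isZariskiClosed_cyclicCoverBase e P, ?_⟩
  rw [vanishingIdeal_cyclicCoverBase hirr]
  exact (Ideal.span_singleton_prime hirr.ne_zero).2 hirr.prime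

/-- **`dim B(e; P) = s`** (a hypersurface in affine `(s+1)`-space cut out by a prime). [folklore] -/
theorem zariskiDim_cyclicCoverBase {e : ℕ} {P : MvPolynomial (Fin s) ℂ}
    (hirr : Irreducible (cyclicCoverPoly e P)) : zariskiDim ℂ (cyclicCoverBase e P) = (s : ℕ) := by
  unfold zariskiDim
  rw [vanishingIdeal_cyclicCoverBase hirr,
    Literature.RingTheory.KrullDimension.ringKrullDim_quotient_span_of_prime_mvPolynomial hirr.prime,
    Nat.add_sub_cancel]

end Irreducible

/-! ### Instances from the problem side -/

section Instances

/-- **The cubic cover of the line** `x₂³ = x₁` (base of the simplest `e = 3` cyclic-cover family of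
the problem side's `ZilberEacComplexCyclicCoverHighOrder`): irreducible closed curve of dimension
`1` with no integer period. [folklore] -/
theorem cubicCoverLine_certificate :
    IsIrreducibleClosed ℂ (cyclicCoverBase 3 (X 0 : MvPolynomial (Fin 1) ℂ)) ∧
      zariskiDim ℂ (cyclicCoverBase 3 (X 0 : MvPolynomial (Fin 1) ℂ)) = (1 : ℕ) ∧
      ¬ HasIntegerPeriod ℂ (cyclicCoverBase 3 (X 0 : MvPolynomial (Fin 1) ℂ)) := by
  have hirr : Irreducible (cyclicCoverPoly 3 (X 0 : MvPolynomial (Fin 1) ℂ)) :=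
    irreducible_cyclicCoverPoly_of_irreducible (by norm_num)
      (MvPolynomial.X_prime : Prime (X 0 : MvPolynomial (Fin 1) ℂ)).irreducible
  refine ⟨isIrreducibleClosed_cyclicCoverBase hirr, zariskiDim_cyclicCoverBase hirr, ?_⟩
  have hX : (X 0 : MvPolynomial (Fin 1) ℂ) = ∑ i, C ((fun _ => (1 : ℂ)) i) * X i + C 0 := by
    simp
  rw [hX, hasIntegerPeriod_cyclicCoverBase_linear_iff (by norm_num) _ _ (by rw [← hX]; exact X_ne_zero 0)]
  rintro ⟨v, hv, h⟩
  apply hv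
  funext i
  fin_cases i
  simpa using h

/-- **The hyperboloid `t² = z² + w² + 1`** (base of the problem side's Theorem H model,
`ZilberEacComplexQuadricCover`), in coordinates `(x₁, x₂, x₃) = (z, w, t)`. [folklore] -/
def hyperboloidModelBase : Set (Fin 3 → ℂ) := {x | x 2 ^ 2 = x 0 ^ 2 + x 1 ^ 2 + 1}

/-- It is the double cover branched along the quadric `x₁² + x₂² + 1` (`M = 1`, `b = 0`, `c = 1`).
[folklore] -/
theorem hyperboloidModelBase_eq :
    hyperboloidModelBase = cyclicCoverBase 2 (quadPoly (1 : Matrix (Fin 2) (Fin 2) ℂ) 0 1) := by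
  ext x
  rw [mem_cyclicCoverBase_iff, eval_quadPoly]
  simp only [hyperboloidModelBase, Set.mem_setOf_eq, quadFun, Matrix.one_apply, Fin.sum_univ_two,
    Fin.isValue, Pi.zero_apply, zero_mul, add_zero]
  have h2 : (Fin.last 2) = (2 : Fin 3) := rfl
  have h0 : (Fin.castSucc (0 : Fin 2)) = (0 : Fin 3) := rfl
  have h1 : (Fin.castSucc (1 : Fin 2)) = (1 : Fin 3) := rfl
  simp only [h2, h0, h1]
  constructor <;> intro h <;> · simp at h ⊢; linear_combination h

/-- **The hyperboloid has no integer period** (`det (M + Mᵀ) = det 2I = 4`), so Theorem H's model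
lives over an aperiodic base: rotundity and additive freeness of the problem side's 3-folds over
it are automatic (`isRotund_of_not_hasIntegerPeriod`). [folklore] -/
theorem not_hasIntegerPeriod_hyperboloidModelBase : ¬ HasIntegerPeriod ℂ hyperboloidModelBase := by
  rw [hyperboloidModelBase_eq]
  refine not_hasIntegerPeriod_cyclicCoverBase_quadPoly_of_det_ne_zero (by norm_num) _ _ _
    (quadPoly_ne_zero_of_quadFun_ne_zero 0 ?_) ?_
  · simp [quadFun]
  · rw [Matrix.transpose_one, Matrix.det_fin_two]
    simp

/-- `eₖ`-slices of seat 2's diagonal quadric shape: `q(t·eₖ) = aₖt² + bₖt + c`. [folklore] -/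
theorem eval_single_diagQuadric {F : Type u} [Field F] {s : ℕ} (a b : Fin s → F) (c t : F)
    (k : Fin s) :
    eval (Pi.single k t) (∑ i, C (a i) * X i ^ 2 + ∑ i, C (b i) * X i + C c : MvPolynomial (Fin s) F)
      = a k * t ^ 2 + b k * t + c := by
  classical
  simp only [map_add, map_sum, map_mul, map_pow, eval_C, eval_X, Pi.single_apply]
  simp only [ite_pow, mul_ite, zero_pow two_ne_zero, mul_zero, Finset.sum_ite_eq',
    Finset.mem_univ, if_true]

/-- A diagonal quadric with some `aₖ ≠ 0` is a nonzero polynomial (char `0`). [folklore] -/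
theorem diagQuadric_ne_zero {F : Type u} [Field F] [CharZero F] {s : ℕ} (a b : Fin s → F) (c : F)
    (k : Fin s) (hk : a k ≠ 0) :
    (∑ i, C (a i) * X i ^ 2 + ∑ i, C (b i) * X i + C c : MvPolynomial (Fin s) F) ≠ 0 := by
  intro h
  have h1 := eval_single_diagQuadric a b c 1 k
  have h2 := eval_single_diagQuadric a b c (-1) k
  have h0 := eval_single_diagQuadric a b c 0 k
  rw [h, map_zero] at h1 h2 h0
  have h3 : 2 * a k = 0 := by linear_combination -h1 - h2 + 2 * h0
  exact hk ((mul_eq_zero.1 h3).resolve_left two_ne_zero)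

/-- Seat 2's diagonal shape is `quadPoly (diagonal a) b c`. [folklore] -/
theorem diagQuadric_eq_quadPoly {F : Type u} [Field F] {s : ℕ} (a b : Fin s → F) (c : F) :
    (∑ i, C (a i) * X i ^ 2 + ∑ i, C (b i) * X i + C c : MvPolynomial (Fin s) F) =
      quadPoly (Matrix.diagonal a) b c := by
  classical
  simp only [quadPoly, Matrix.diagonal_apply]
  congr 1
  congr 1
  refine Finset.sum_congr rfl fun i _ => ?_
  rw [Finset.sum_eq_single i]
  · rw [if_pos rfl]; ring
  · intro j _ hj
    rw [if_neg (Ne.symm hj), C_0, zero_mul, zero_mul]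
  · intro hi
    exact absurd (Finset.mem_univ i) hi

/-- **Integer-period test for diagonal quadric covers** `x_{s+1}^e = Σ aᵢxᵢ² + Σ bᵢxᵢ + c`
(`e ≥ 2`, the quadric nonzero): periodic iff some `v ∈ ℤˢ ∖ 0` has `aᵢvᵢ = 0` for all `i` and
`Σ bᵢvᵢ = 0`. [folklore] -/
theorem hasIntegerPeriod_cyclicCoverBase_diagQuadric_iff {s e : ℕ} (he : 2 ≤ e) (a b : Fin s → ℂ)
    (c : ℂ) (hne : (∑ i, C (a i) * X i ^ 2 + ∑ i, C (b i) * X i + C c : MvPolynomial (Fin s) ℂ) ≠ 0) :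
    HasIntegerPeriod ℂ (cyclicCoverBase e (∑ i, C (a i) * X i ^ 2 + ∑ i, C (b i) * X i + C c)) ↔
      ∃ v : Fin s → ℤ, v ≠ 0 ∧ (∀ i, a i * (v i : ℂ) = 0) ∧ ∑ i, b i * (v i : ℂ) = 0 := by
  classical
  rw [diagQuadric_eq_quadPoly] at hne ⊢
  rw [hasIntegerPeriod_cyclicCoverBase_quadPoly_iff he _ _ _ hne]
  refine exists_congr fun v => and_congr_right fun _ => and_congr_left fun _ => ?_
  refine forall_congr' fun i => ?_
  have hdiag : ∑ j, (Matrix.diagonal a i j + Matrix.diagonal a j i) * (v j : ℂ) =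
      2 * (a i * (v i : ℂ)) := by
    rw [Finset.sum_eq_single i]
    · simp only [Matrix.diagonal_apply_eq]; ring
    · intro j _ hj
      rw [Matrix.diagonal_apply_ne _ (Ne.symm hj), Matrix.diagonal_apply_ne _ hj, add_zero,
        zero_mul]
    · intro hi
      exact absurd (Finset.mem_univ i) hi
  rw [hdiag, mul_eq_zero, or_iff_right (two_ne_zero' ℂ)]

/-- **Sphere / hyperboloid covers of any order are aperiodic**: `x_{s+1}^e = Σ aᵢxᵢ² + Σ bᵢxᵢ + c`
with every `aᵢ ≠ 0` (`e ≥ 2`, `s ≥ 1`) has no integer period; so the problem side's sphere and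
hyperboloid double covers live over aperiodic bases (rotundity-free sub-cell). [folklore] -/
theorem not_hasIntegerPeriod_cyclicCoverBase_diagQuadric {s e : ℕ} (he : 2 ≤ e) (hs : 0 < s)
    (a b : Fin s → ℂ) (c : ℂ) (ha : ∀ i, a i ≠ 0) :
    ¬ HasIntegerPeriod ℂ (cyclicCoverBase e (∑ i, C (a i) * X i ^ 2 + ∑ i, C (b i) * X i + C c)) := by
  rw [hasIntegerPeriod_cyclicCoverBase_diagQuadric_iff he a b c
    (diagQuadric_ne_zero a b c ⟨0, hs⟩ (ha _))]
  rintro ⟨v, hv, hk, -⟩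
  apply hv
  funext i
  have hi := (mul_eq_zero.1 (hk i)).resolve_left (ha i)
  have : v i = 0 := by exact_mod_cast hi
  rw [this, Pi.zero_apply]

end Instances


/-! ### Poly-fibred cyclic covers: the family-level certificate

`W(e; P; A, F) = {x_{s+1}^e = P(x′), yⱼ = Aⱼ(x′) + y_{s+1} Fⱼ(y_{s+1}, x′)}` — the cyclic-cover
analogue of `EACRotundityProofs.polyFibredGraph` (same fibres, base `B(e; P)` instead of a graph).
It is parametrised by the hypersurface `B̃ = B(e; P) × 𝔸¹_u ⊆ ℂ^{s+2}` (coordinates `(x′, u, x_{s+1})`,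
so that `B̃ = cyclicCoverBase e (rename castSucc P)`), whence `I(W) = θ⁻¹ (I(B̃))` for the onto
substitution `θ : ℂ[X, Y] → ℂ[x′, u, x_{s+1}]`, `ℂ[W] ≅ ℂ[x′, u, x_{s+1}]/(x_{s+1}^e − P)`,
`dim W = s + 1`; the multiplicative projection of `W ∩ Gⁿ` is that of the poly-fibred GRAPH with the
same fibres (the base coordinate does not enter), so it is dominant as soon as
`τ : Yⱼ ↦ Ãⱼ + U F̃ⱼ, Yₙ ↦ U` is injective; and `I(π(W ∩ Gⁿ)) = I(B(e; P))`. -/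

section FibredCover

variable {s : ℕ}

/-- **`W(e; P; A, F) ⊆ ℂⁿ × ℂⁿ`** (`n = s + 1`): `xₙ^e = P(x′)` and
`yⱼ = Aⱼ(x′) + yₙ · Fⱼ(yₙ, x′)` (`j ≤ s`; `Fⱼ ∈ ℂ[u, x′]`, variable `0` is `u`). The problem side's
quadric-cover / hyperboloid systems (`ZilberEacComplexQuadricCover`, fibres `Aⱼ(x′) + yₙFⱼ(yₙ)`) are
literally of this form. [cite: MantovaMasser2023, §1 p. 5 (the open case)] -/
def polyFibredCover (e : ℕ) (P : MvPolynomial (Fin s) ℂ) (A : Fin s → MvPolynomial (Fin s) ℂ)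
    (F : Fin s → MvPolynomial (Fin (s + 1)) ℂ) : Set (Fin (s + 1) ⊕ Fin (s + 1) → ℂ) :=
  {z | z (Sum.inl (Fin.last s)) ^ e = eval (fun j => z (Sum.inl (Fin.castSucc j))) P ∧
    ∀ j : Fin s, z (Sum.inr (Fin.castSucc j)) =
      eval (fun i => z (Sum.inl (Fin.castSucc i))) (A j) +
        z (Sum.inr (Fin.last s)) *
          eval (Fin.cons (z (Sum.inr (Fin.last s))) fun i => z (Sum.inl (Fin.castSucc i))) (F j)}

variable (e : ℕ) (P : MvPolynomial (Fin s) ℂ) (A : Fin s → MvPolynomial (Fin s) ℂ)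
  (F : Fin s → MvPolynomial (Fin (s + 1)) ℂ)

/-- Membership in `W(e; P; A, F)`. [folklore] -/
theorem mem_polyFibredCover_iff (z : Fin (s + 1) ⊕ Fin (s + 1) → ℂ) :
    z ∈ polyFibredCover e P A F ↔
      z (Sum.inl (Fin.last s)) ^ e = eval (fun j => z (Sum.inl (Fin.castSucc j))) P ∧
        ∀ j : Fin s, z (Sum.inr (Fin.castSucc j)) =
          eval (fun i => z (Sum.inl (Fin.castSucc i))) (A j) +
            z (Sum.inr (Fin.last s)) *
              eval (Fin.cons (z (Sum.inr (Fin.last s))) fun i => z (Sum.inl (Fin.castSucc i)))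
                (F j) :=
  Iff.rfl

/-- The additive coordinates of a point of `W` lie on the base `B(e; P)`. [folklore] -/
theorem projAdd_mem_cyclicCoverBase {z : Fin (s + 1) ⊕ Fin (s + 1) → ℂ}
    (hz : z ∈ polyFibredCover e P A F) : projAdd z ∈ cyclicCoverBase e P := by
  rw [mem_cyclicCoverBase_iff]
  simp only [projAdd_apply]
  exact hz.1

/-- The parametrisation `(x′, t, u) ↦ ((x′, t), Ã(x′) + u F̃(u, x′), u)` (`t^e = P(x′)`). [folklore] -/
noncomputable def pcParam (x : Fin s → ℂ) (t u : ℂ) : Fin (s + 1) ⊕ Fin (s + 1) → ℂ :=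
  Sum.elim (Fin.snoc x t : Fin (s + 1) → ℂ) (pMulParam A F x u)

/-- Coordinates of the parametrisation. [folklore] -/
@[simp] theorem pcParam_inl_last (x : Fin s → ℂ) (t u : ℂ) :
    pcParam A F x t u (Sum.inl (Fin.last s)) = t := by
  simp [pcParam]

/-- Coordinates of the parametrisation. [folklore] -/
@[simp] theorem pcParam_inl_castSucc (x : Fin s → ℂ) (t u : ℂ) (j : Fin s) :
    pcParam A F x t u (Sum.inl (Fin.castSucc j)) = x j := by
  simp [pcParam]

/-- Coordinates of the parametrisation. [folklore] -/
@[simp] theorem pcParam_inr (x : Fin s → ℂ) (t u : ℂ) (i : Fin (s + 1)) :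
    pcParam A F x t u (Sum.inr i) = pMulParam A F x u i := by
  simp [pcParam]

/-- The parametrisation lands in `W` over points of the base. [folklore] -/
theorem pcParam_mem {x : Fin s → ℂ} {t : ℂ} (u : ℂ) (ht : t ^ e = eval x P) :
    pcParam A F x t u ∈ polyFibredCover e P A F := by
  refine ⟨?_, fun j => ?_⟩
  · simp only [pcParam_inl_last, pcParam_inl_castSucc]
    exact ht
  · simp only [pcParam_inr, pMulParam_castSucc, pcParam_inl_castSucc, pMulParam_last]

/-- Every point of `W` is the parametrised point of its coordinates `(x′, xₙ, yₙ)`. [folklore] -/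
theorem eq_pcParam_of_mem {z : Fin (s + 1) ⊕ Fin (s + 1) → ℂ} (hz : z ∈ polyFibredCover e P A F) :
    z = pcParam A F (fun j => z (Sum.inl (Fin.castSucc j))) (z (Sum.inl (Fin.last s)))
      (z (Sum.inr (Fin.last s))) := by
  funext v
  rcases v with i | i
  · induction i using Fin.lastCases with
    | last => rw [pcParam_inl_last]
    | cast j => rw [pcParam_inl_castSucc]
  · rw [pcParam_inr]
    induction i using Fin.lastCases with
    | last => rw [pMulParam_last]
    | cast j => rw [pMulParam_castSucc]; exact hz.2 j

/-- The additive part of a parametrised point. [folklore] -/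
theorem projAdd_pcParam (x : Fin s → ℂ) (t u : ℂ) :
    projAdd (pcParam A F x t u) = (Fin.snoc x t : Fin (s + 1) → ℂ) := by
  funext i
  rw [projAdd_apply]
  induction i using Fin.lastCases with
  | last => rw [pcParam_inl_last, Fin.snoc_last]
  | cast j => rw [pcParam_inl_castSucc, Fin.snoc_castSucc]

/-- The multiplicative part of a parametrised point is that of the poly-fibred GRAPH with the same
fibres — the base coordinate does not enter. [folklore] -/
theorem projMul_pcParam (x : Fin s → ℂ) (t u : ℂ) :
    projMul (pcParam A F x t u) = pMulParam A F x u := by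
  funext i
  rw [projMul_apply, pcParam_inr]

/-- If `∏ᵢ pMulSubst i` does not vanish at `(x′, u)`, the parametrised point is in the torus.
[folklore] -/
theorem pcParam_mem_torusLocus_of_eval_ne_zero {x : Fin s → ℂ} {u : ℂ} (t : ℂ)
    (hc : eval (Fin.snoc x u : Fin (s + 1) → ℂ) (∏ i, pMulSubst A F i) ≠ 0) :
    pcParam A F x t u ∈ torusLocus ℂ (s + 1) := by
  intro i
  rw [pcParam_inr, ← eval_snoc_pMulSubst]
  rw [map_prod] at hc
  exact Finset.prod_ne_zero_iff.1 hc i (Finset.mem_univ i)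

/-! #### The ring `ℂ[x′, u, x_{s+1}]` and the substitution `θ` -/

/-- The embedding `ℂ[x′, x_{s+1}] ↪ ℂ[x′, u, x_{s+1}]` of index sets: `castSucc i ↦ i`,
`last ↦ last` (the slot `s` of `Fin (s+2)` is the new variable `u`). [folklore] -/
def skipU (s : ℕ) : Fin (s + 1) → Fin (s + 1 + 1) := fun k =>
  Fin.lastCases (Fin.last (s + 1)) (fun i : Fin s => (Fin.castSucc i).castSucc) k

/-- `skipU last = last`. [folklore] -/
@[simp] theorem skipU_last : skipU s (Fin.last s) = Fin.last (s + 1) := by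
  simp [skipU]

/-- `skipU (castSucc i) = castSucc (castSucc i)`. [folklore] -/
@[simp] theorem skipU_castSucc (i : Fin s) :
    skipU s (Fin.castSucc i) = (Fin.castSucc i).castSucc := by
  simp [skipU]

/-- `skipU` is injective. [folklore] -/
theorem skipU_injective : Function.Injective (skipU s) := by
  intro a b h
  induction a using Fin.lastCases with
  | last =>
    induction b using Fin.lastCases with
    | last => rfl
    | cast j =>
      rw [skipU_last, skipU_castSucc] at h
      exact absurd h.symm (Fin.castSucc_lt_last _).ne
  | cast i =>
    induction b using Fin.lastCases with
    | last =>
      rw [skipU_last, skipU_castSucc] at h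
      exact absurd h (Fin.castSucc_lt_last _).ne
    | cast j =>
      rw [skipU_castSucc, skipU_castSucc] at h
      rw [Fin.castSucc_injective _ (Fin.castSucc_injective _ h)]

/-- Reading the `(x′, x_{s+1})`-coordinates of `(x′, u, t)`. [folklore] -/
theorem snoc_snoc_skipU (x : Fin s → ℂ) (u t : ℂ) (k : Fin (s + 1)) :
    (Fin.snoc (Fin.snoc x u : Fin (s + 1) → ℂ) t : Fin (s + 1 + 1) → ℂ) (skipU s k) =
      (Fin.snoc x t : Fin (s + 1) → ℂ) k := by
  induction k using Fin.lastCases with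
  | last => simp only [skipU_last, Fin.snoc_last]
  | cast i => simp only [skipU_castSucc, Fin.snoc_castSucc]

/-- The same, as functions. [folklore] -/
theorem snoc_snoc_comp_skipU (x : Fin s → ℂ) (u t : ℂ) :
    (Fin.snoc (Fin.snoc x u : Fin (s + 1) → ℂ) t : Fin (s + 1 + 1) → ℂ) ∘ skipU s =
      (Fin.snoc x t : Fin (s + 1) → ℂ) :=
  funext fun k => snoc_snoc_skipU x u t k

/-- `x_{s+1}^e - P(x′)` read in `ℂ[x′, u, x_{s+1}]` is the cyclic-cover polynomial of
`P̃ = P ∈ ℂ[x′, u]`. [folklore] -/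
theorem rename_skipU_cyclicCoverPoly :
    rename (skipU s) (cyclicCoverPoly e P) = cyclicCoverPoly e (rename Fin.castSucc P) := by
  have hcomp : (skipU s ∘ Fin.castSucc : Fin s → Fin (s + 1 + 1)) = Fin.castSucc ∘ Fin.castSucc :=
    funext fun i => skipU_castSucc i
  simp only [cyclicCoverPoly, map_sub, map_pow, rename_X, skipU_last, rename_rename, hcomp]

/-- Renaming along an injection preserves primality (reduction to Mathlib's
`MvPolynomial.prime_rename_iff` for subtype inclusions). [folklore] -/
theorem prime_rename_of_injective {σ τ : Type*} {f : σ → τ} (hf : Function.Injective f)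
    {p : MvPolynomial σ ℂ} (hp : Prime p) : Prime (rename f p) := by
  classical
  have hfe : f = ((↑) : Set.range f → τ) ∘ (Equiv.ofInjective f hf) := by
    funext a
    rfl
  rw [hfe, ← rename_rename]
  refine (MvPolynomial.prime_rename_iff (Set.range f)).2 ?_
  exact (MulEquiv.prime_iff (renameEquiv ℂ (Equiv.ofInjective f hf))).2 hp

/-- `x_{s+1}^e - P` stays irreducible in `ℂ[x′, u, x_{s+1}]`. [folklore] -/
theorem irreducible_cyclicCoverPoly_rename_castSucc {e : ℕ} {P : MvPolynomial (Fin s) ℂ}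
    (hirr : Irreducible (cyclicCoverPoly e P)) :
    Irreducible (cyclicCoverPoly e (rename Fin.castSucc P) : MvPolynomial (Fin (s + 1 + 1)) ℂ) := by
  rw [← rename_skipU_cyclicCoverPoly]
  exact (prime_rename_of_injective skipU_injective
    (UniqueFactorizationMonoid.irreducible_iff_prime.1 hirr)).irreducible

/-- `(x′, u, t) ∈ B̃ = B(e; P̃)` iff `t^e = P(x′)`. [folklore] -/
theorem snoc_snoc_mem_cyclicCoverBase_iff (x : Fin s → ℂ) (u t : ℂ) :
    (Fin.snoc (Fin.snoc x u : Fin (s + 1) → ℂ) t : Fin (s + 1 + 1) → ℂ) ∈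
        cyclicCoverBase e (rename Fin.castSucc P) ↔ t ^ e = eval x P := by
  rw [snoc_mem_cyclicCoverBase_iff, eval_rename, snoc_comp_castSucc]

/-- Splitting a point of `ℂ^{s+2}` as `(x′, u, t)`. [folklore] -/
theorem eq_snoc_snoc (c : Fin (s + 1 + 1) → ℂ) :
    c = Fin.snoc (Fin.snoc (Fin.init (Fin.init c)) (Fin.init c (Fin.last s)) : Fin (s + 1) → ℂ)
      (c (Fin.last (s + 1))) := by
  conv_lhs => rw [← Fin.snoc_init_self c, ← Fin.snoc_init_self (Fin.init c)]

/-- **The substitution `θ : ℂ[X, Y] → ℂ[x′, u, x_{s+1}]`**: `Xᵢ ↦ xᵢ`, `Yⱼ ↦ Ãⱼ + U F̃ⱼ`,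
`Yₙ ↦ U`. [folklore] -/
noncomputable def pcSubst : Fin (s + 1) ⊕ Fin (s + 1) → MvPolynomial (Fin (s + 1 + 1)) ℂ :=
  Sum.elim (fun k => X (skipU s k)) (fun k => rename Fin.castSucc (pMulSubst A F k))

/-- Evaluating `θ` at `(x′, u, t)` gives the parametrised point. [folklore] -/
theorem eval_pcSubst (x : Fin s → ℂ) (u t : ℂ) (v : Fin (s + 1) ⊕ Fin (s + 1)) :
    eval (Fin.snoc (Fin.snoc x u : Fin (s + 1) → ℂ) t : Fin (s + 1 + 1) → ℂ) (pcSubst A F v) =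
      pcParam A F x t u v := by
  rcases v with k | k
  · simp only [pcSubst, Sum.elim_inl, eval_X, snoc_snoc_skipU]
    induction k using Fin.lastCases with
    | last => rw [Fin.snoc_last, pcParam_inl_last]
    | cast j => rw [Fin.snoc_castSucc, pcParam_inl_castSucc]
  · simp only [pcSubst, Sum.elim_inr, eval_rename, snoc_comp_castSucc, eval_snoc_pMulSubst,
      pcParam_inr]

/-- `(θ p)(x′, u, t) = p(pcParam x′ t u)`. [folklore] -/
theorem eval_aeval_pcSubst (x : Fin s → ℂ) (u t : ℂ)
    (p : MvPolynomial (Fin (s + 1) ⊕ Fin (s + 1)) ℂ) :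
    eval (Fin.snoc (Fin.snoc x u : Fin (s + 1) → ℂ) t : Fin (s + 1 + 1) → ℂ)
        (aeval (pcSubst A F) p) = aeval (pcParam A F x t u) p := by
  have hfun : (fun v => eval (Fin.snoc (Fin.snoc x u : Fin (s + 1) → ℂ) t : Fin (s + 1 + 1) → ℂ)
      (pcSubst A F v)) = pcParam A F x t u :=
    funext fun v => eval_pcSubst A F x u t v
  rw [eval_aeval_eq_aeval, hfun]

/-- `θ` is onto. [folklore] -/
theorem pcSubst_surjective :
    Function.Surjective (aeval (pcSubst A F) :
      MvPolynomial (Fin (s + 1) ⊕ Fin (s + 1)) ℂ →ₐ[ℂ] MvPolynomial (Fin (s + 1 + 1)) ℂ) := by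
  intro r
  let back : Fin (s + 1 + 1) → Fin (s + 1) ⊕ Fin (s + 1) := fun k =>
    Fin.lastCases (Sum.inl (Fin.last s))
      (fun k' : Fin (s + 1) =>
        Fin.lastCases (Sum.inr (Fin.last s)) (fun i : Fin s => Sum.inl (Fin.castSucc i)) k') k
  refine ⟨rename back r, ?_⟩
  rw [aeval_rename]
  have hX : (pcSubst A F ∘ back) = X := by
    funext k
    induction k using Fin.lastCases with
    | last => simp [back, pcSubst]
    | cast k' =>
      induction k' using Fin.lastCases with
      | last => simp [back, pcSubst]
      | cast i => simp [back, pcSubst]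
  rw [hX, aeval_X_left_apply]

/-- **`I(W) = θ⁻¹(I(B̃))`**: `W` is the image of `B̃ = B(e; P) × 𝔸¹` under the point map of `θ`.
[folklore] -/
theorem vanishingIdeal_polyFibredCover :
    vanishingIdeal ℂ (polyFibredCover e P A F) =
      Ideal.comap (aeval (pcSubst A F) :
          MvPolynomial (Fin (s + 1) ⊕ Fin (s + 1)) ℂ →ₐ[ℂ] MvPolynomial (Fin (s + 1 + 1)) ℂ)
        (vanishingIdeal ℂ (cyclicCoverBase e (rename Fin.castSucc P))) := by
  ext p
  rw [Ideal.mem_comap, mem_vanishingIdeal_iff, mem_vanishingIdeal_iff]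
  constructor
  · intro hp c hc
    rw [eq_snoc_snoc c] at hc ⊢
    rw [snoc_snoc_mem_cyclicCoverBase_iff] at hc
    change eval _ (aeval (pcSubst A F) p) = 0
    rw [eval_aeval_pcSubst]
    exact hp _ (pcParam_mem e P A F _ hc)
  · intro hp z hz
    have hc : (Fin.snoc (Fin.snoc (fun j => z (Sum.inl (Fin.castSucc j))) (z (Sum.inr (Fin.last s))) :
        Fin (s + 1) → ℂ) (z (Sum.inl (Fin.last s))) : Fin (s + 1 + 1) → ℂ) ∈
          cyclicCoverBase e (rename Fin.castSucc P) := by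
      rw [snoc_snoc_mem_cyclicCoverBase_iff]
      exact hz.1
    have key := hp _ hc
    change eval _ (aeval (pcSubst A F) p) = 0 at key
    rw [eval_aeval_pcSubst, ← eq_pcParam_of_mem e P A F hz] at key
    exact key

/-- **`W(e; P; A, F)` is Zariski closed** (its equations lie in `I(W)`). [folklore] -/
theorem isZariskiClosed_polyFibredCover : IsZariskiClosed ℂ (polyFibredCover e P A F) := by
  classical
  refine ⟨vanishingIdeal ℂ (polyFibredCover e P A F), ?_⟩
  refine le_antisymm (zeroLocus_vanishingIdeal_le _) fun z hz => ?_
  have hmem : ∀ q ∈ vanishingIdeal ℂ (polyFibredCover e P A F), aeval z q = 0 :=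
    (mem_zeroLocus_iff.1 hz)
  have e0 : (X (Sum.inl (Fin.last s)) ^ e - rename (Sum.inl ∘ Fin.castSucc) P :
      MvPolynomial (Fin (s + 1) ⊕ Fin (s + 1)) ℂ) ∈ vanishingIdeal ℂ (polyFibredCover e P A F) := by
    rw [mem_vanishingIdeal_iff]
    intro w hw
    rw [map_sub, map_pow, aeval_X, aeval_rename, hw.1, sub_eq_zero]
    rfl
  let κ : Fin (s + 1) → Fin (s + 1) ⊕ Fin (s + 1) :=
    Fin.cons (Sum.inr (Fin.last s)) (Sum.inl ∘ Fin.castSucc)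
  have hκ : ∀ w : Fin (s + 1) ⊕ Fin (s + 1) → ℂ, (w ∘ κ) =
      (Fin.cons (w (Sum.inr (Fin.last s))) fun j => w (Sum.inl (Fin.castSucc j))) := by
    intro w
    funext i
    refine Fin.cases ?_ (fun j => ?_) i
    · simp [κ]
    · simp [κ]
  have ej : ∀ j : Fin s, (X (Sum.inr (Fin.castSucc j)) - (rename (Sum.inl ∘ Fin.castSucc) (A j) +
      X (Sum.inr (Fin.last s)) * rename κ (F j)) :
        MvPolynomial (Fin (s + 1) ⊕ Fin (s + 1)) ℂ) ∈ vanishingIdeal ℂ (polyFibredCover e P A F) := by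
    intro j
    rw [mem_vanishingIdeal_iff]
    intro w hw
    simp only [map_sub, map_add, map_mul, aeval_X, aeval_rename, hκ w, hw.2 j, sub_eq_zero]
    rfl
  refine ⟨?_, fun j => ?_⟩
  · have h0 := hmem _ e0
    rw [map_sub, map_pow, aeval_X, aeval_rename, sub_eq_zero] at h0
    exact h0
  · have h1 := hmem _ (ej j)
    simp only [map_sub, map_add, map_mul, aeval_X, aeval_rename, hκ z, sub_eq_zero] at h1
    exact h1

variable {e P}

/-- `e ≥ 2` and `x_{s+1}^e - P` irreducible force `P ≠ 0` (`X^e` is reducible). [folklore] -/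
theorem ne_zero_of_irreducible_cyclicCoverPoly (he : 2 ≤ e) (hirr : Irreducible (cyclicCoverPoly e P)) :
    P ≠ 0 := by
  rintro rfl
  have h : cyclicCoverPoly e (0 : MvPolynomial (Fin s) ℂ) =
      X (Fin.last s) * X (Fin.last s) ^ (e - 1) := by
    rw [cyclicCoverPoly, map_zero, sub_zero, ← pow_succ', Nat.sub_add_cancel (by omega)]
  rw [h] at hirr
  have hX : ¬ IsUnit (X (Fin.last s) : MvPolynomial (Fin (s + 1)) ℂ) :=
    (MvPolynomial.X_prime : Prime (X (Fin.last s) : MvPolynomial (Fin (s + 1)) ℂ)).not_unit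
  rcases hirr.isUnit_or_isUnit rfl with h1 | h1
  · exact hX h1
  · exact hX (isUnit_of_dvd_unit (dvd_pow_self _ (by omega)) h1)

/-- **`I(W) = θ⁻¹((x_{s+1}^e - P))`** for irreducible `x_{s+1}^e - P`. [folklore] -/
theorem vanishingIdeal_polyFibredCover_eq_comap_span (hirr : Irreducible (cyclicCoverPoly e P)) :
    vanishingIdeal ℂ (polyFibredCover e P A F) =
      Ideal.comap (aeval (pcSubst A F) :
          MvPolynomial (Fin (s + 1) ⊕ Fin (s + 1)) ℂ →ₐ[ℂ] MvPolynomial (Fin (s + 1 + 1)) ℂ)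
        (Ideal.span {cyclicCoverPoly e (rename Fin.castSucc P)}) := by
  rw [vanishingIdeal_polyFibredCover,
    vanishingIdeal_cyclicCoverBase (irreducible_cyclicCoverPoly_rename_castSucc hirr)]

/-- **`W(e; P; A, F)` is an irreducible closed set** when `x_{s+1}^e - P` is irreducible.
[folklore] -/
theorem isIrreducibleClosed_polyFibredCover (hirr : Irreducible (cyclicCoverPoly e P)) :
    IsIrreducibleClosed ℂ (polyFibredCover e P A F) := by
  refine ⟨isZariskiClosed_polyFibredCover e P A F, ?_⟩
  have hirr' := irreducible_cyclicCoverPoly_rename_castSucc hirr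
  haveI : (Ideal.span {cyclicCoverPoly e (rename Fin.castSucc P)}).IsPrime :=
    (Ideal.span_singleton_prime hirr'.ne_zero).2 hirr'.prime
  rw [vanishingIdeal_polyFibredCover_eq_comap_span A F hirr]
  exact Ideal.IsPrime.comap _

/-- **`dim W(e; P; A, F) = s + 1`**: `ℂ[W] ≅ ℂ[x′, u, x_{s+1}]/(x_{s+1}^e - P)`, a hypersurface ring
in `s + 2` variables (`Literature.RingTheory.KrullDimension`). [folklore] -/
theorem zariskiDim_polyFibredCover (hirr : Irreducible (cyclicCoverPoly e P)) :
    zariskiDim ℂ (polyFibredCover e P A F) = (s + 1 : ℕ) := by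
  have hirr' := irreducible_cyclicCoverPoly_rename_castSucc hirr
  set J : Ideal (MvPolynomial (Fin (s + 1 + 1)) ℂ) :=
    Ideal.span {cyclicCoverPoly e (rename Fin.castSucc P)} with hJ
  let f : MvPolynomial (Fin (s + 1) ⊕ Fin (s + 1)) ℂ →ₐ[ℂ] (MvPolynomial (Fin (s + 1 + 1)) ℂ ⧸ J) :=
    (Ideal.Quotient.mkₐ ℂ J).comp (aeval (pcSubst A F))
  have hf : Function.Surjective f :=
    (Ideal.Quotient.mkₐ_surjective ℂ J).comp (pcSubst_surjective A F)
  have hker : RingHom.ker f = vanishingIdeal ℂ (polyFibredCover e P A F) := by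
    rw [vanishingIdeal_polyFibredCover_eq_comap_span A F hirr]
    ext p
    simp only [RingHom.mem_ker, Ideal.mem_comap, f, AlgHom.comp_apply, Ideal.Quotient.mkₐ_eq_mk,
      Ideal.Quotient.eq_zero_iff_mem]
    exact Iff.rfl
  unfold zariskiDim
  rw [← hker, ringKrullDim_eq_of_ringEquiv (Ideal.quotientKerAlgEquivOfSurjective hf).toRingEquiv,
    hJ, Literature.RingTheory.KrullDimension.ringKrullDim_quotient_span_of_prime_mvPolynomial
      hirr'.prime, Nat.add_sub_cancel]

/-- **`W ∩ Gⁿ ≠ ∅`** when `τ` is injective (`e ≥ 1`). [folklore] -/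
theorem polyFibredCover_inter_torusLocus_nonempty (he : 0 < e)
    (hτ : Function.Injective (aeval (pMulSubst A F) :
      MvPolynomial (Fin (s + 1)) ℂ →ₐ[ℂ] MvPolynomial (Fin (s + 1)) ℂ)) :
    (polyFibredCover e P A F ∩ torusLocus ℂ (s + 1)).Nonempty := by
  have hU : (∏ i, pMulSubst A F i) ≠ 0 :=
    Finset.prod_ne_zero_iff.2 fun i _ h0 =>
      X_ne_zero i (hτ (by rw [aeval_X, map_zero]; exact h0))
  obtain ⟨c, hc⟩ : ∃ c : Fin (s + 1) → ℂ, eval c (∏ i, pMulSubst A F i) ≠ 0 := by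
    by_contra h
    simp only [not_exists, not_not] at h
    exact hU (MvPolynomial.funext fun c => by rw [h c, map_zero])
  obtain ⟨t, ht⟩ := IsAlgClosed.exists_pow_nat_eq (eval (Fin.init c) P) he
  have hc' : eval (Fin.snoc (Fin.init c) (c (Fin.last s)) : Fin (s + 1) → ℂ)
      (∏ i, pMulSubst A F i) ≠ 0 := by
    rwa [Fin.snoc_init_self]
  exact ⟨_, pcParam_mem e P A F _ ht, pcParam_mem_torusLocus_of_eval_ne_zero A F t hc'⟩

/-- **Dominant multiplicative projection** of `W ∩ Gⁿ` when `τ` is injective (`e ≥ 1`): the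
multiplicative coordinates of `W` are those of the poly-fibred graph with the same fibres.
[folklore] -/
theorem hasDominantMulProjection_polyFibredCover (he : 0 < e)
    (hτ : Function.Injective (aeval (pMulSubst A F) :
      MvPolynomial (Fin (s + 1)) ℂ →ₐ[ℂ] MvPolynomial (Fin (s + 1)) ℂ)) :
    HasDominantMulProjection ℂ (polyFibredCover e P A F ∩ torusLocus ℂ (s + 1)) := by
  intro p hp
  have hU : (∏ i, pMulSubst A F i) ≠ 0 :=
    Finset.prod_ne_zero_iff.2 fun i _ h0 =>
      X_ne_zero i (hτ (by rw [aeval_X, map_zero]; exact h0))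
  have hPU : aeval (pMulSubst A F) p * ∏ i, pMulSubst A F i = 0 := by
    apply MvPolynomial.funext
    intro c
    rw [map_zero, map_mul]
    by_cases hc : eval c (∏ i, pMulSubst A F i) = 0
    · rw [hc, mul_zero]
    · obtain ⟨t, ht⟩ := IsAlgClosed.exists_pow_nat_eq (eval (Fin.init c) P) he
      have hc' : eval (Fin.snoc (Fin.init c) (c (Fin.last s)) : Fin (s + 1) → ℂ)
          (∏ i, pMulSubst A F i) ≠ 0 := by
        rwa [Fin.snoc_init_self]
      have hT := pcParam_mem_torusLocus_of_eval_ne_zero A F t hc'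
      have h0 := hp _ ⟨pcParam_mem e P A F _ ht, hT⟩
      rw [projMul_pcParam] at h0
      rw [eval_aeval_pMulSubst, h0, zero_mul]
  have hP0 : aeval (pMulSubst A F) p = 0 := (mul_eq_zero.1 hPU).resolve_right hU
  exact hτ (by rw [hP0, map_zero])

/-- `W ∩ Gⁿ` is multiplicatively free (`τ` injective). [folklore] -/
theorem isMulFree_polyFibredCover (he : 0 < e)
    (hτ : Function.Injective (aeval (pMulSubst A F) :
      MvPolynomial (Fin (s + 1)) ℂ →ₐ[ℂ] MvPolynomial (Fin (s + 1)) ℂ)) :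
    IsMulFree ℂ (s + 1) (polyFibredCover e P A F ∩ torusLocus ℂ (s + 1)) :=
  isMulFree_of_hasDominantMulProjection Set.inter_subset_right
    (hasDominantMulProjection_polyFibredCover A F he hτ)

/-- `W ∩ Gⁿ` is ROTUND (irreducible cover, `τ` injective; gen 5's
`isRotund_of_hasDominantMulProjection`). [folklore] -/
theorem isRotund_polyFibredCover (he : 0 < e) (hirr : Irreducible (cyclicCoverPoly e P))
    (hτ : Function.Injective (aeval (pMulSubst A F) :
      MvPolynomial (Fin (s + 1)) ℂ →ₐ[ℂ] MvPolynomial (Fin (s + 1)) ℂ)) :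
    IsRotund ℂ (s + 1) (polyFibredCover e P A F ∩ torusLocus ℂ (s + 1)) :=
  isRotund_of_hasDominantMulProjection (isIrreducibleClosed_polyFibredCover A F hirr)
    (polyFibredCover_inter_torusLocus_nonempty A F he hτ)
    (hasDominantMulProjection_polyFibredCover A F he hτ)

/-- **`I(π(W ∩ Gⁿ)) = I(B(e; P))`**: `π(W ∩ Gⁿ)` is `B` minus the proper closed subset over which
`∏ pMulSubst(x′, ·) ≡ 0`; a polynomial `p` vanishing there gives `p̃ · Π̃ ∈ I(B̃) = (x_{s+1}^e - P)`
in `ℂ[x′, u, x_{s+1}]` with `Π̃ ∉ (x_{s+1}^e - P)`. [folklore] -/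
theorem vanishingIdeal_projAdd_polyFibredCover (he : 0 < e)
    (hirr : Irreducible (cyclicCoverPoly e P))
    (hτ : Function.Injective (aeval (pMulSubst A F) :
      MvPolynomial (Fin (s + 1)) ℂ →ₐ[ℂ] MvPolynomial (Fin (s + 1)) ℂ)) :
    vanishingIdeal ℂ (projAdd '' (polyFibredCover e P A F ∩ torusLocus ℂ (s + 1))) =
      vanishingIdeal ℂ (cyclicCoverBase e P) := by
  have hirr' := irreducible_cyclicCoverPoly_rename_castSucc hirr
  have hprime : (Ideal.span {cyclicCoverPoly e (rename Fin.castSucc P)}).IsPrime :=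
    (Ideal.span_singleton_prime hirr'.ne_zero).2 hirr'.prime
  have hU : (∏ i, pMulSubst A F i) ≠ 0 :=
    Finset.prod_ne_zero_iff.2 fun i _ h0 =>
      X_ne_zero i (hτ (by rw [aeval_X, map_zero]; exact h0))
  refine le_antisymm ?_ ?_
  · intro p hp
    rw [mem_vanishingIdeal_iff] at hp
    have hq : rename (skipU s) p * rename Fin.castSucc (∏ i, pMulSubst A F i) ∈
        vanishingIdeal ℂ (cyclicCoverBase e (rename Fin.castSucc P)) := by
      rw [mem_vanishingIdeal_iff]
      intro c hc
      rw [eq_snoc_snoc c] at hc ⊢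
      rw [snoc_snoc_mem_cyclicCoverBase_iff] at hc
      rw [map_mul]
      change eval _ (rename (skipU s) p) * eval _ (rename Fin.castSucc (∏ i, pMulSubst A F i)) = 0
      rw [eval_rename, eval_rename, snoc_snoc_comp_skipU, snoc_comp_castSucc]
      by_cases hcu : eval (Fin.snoc (Fin.init (Fin.init c)) (Fin.init c (Fin.last s)) :
          Fin (s + 1) → ℂ) (∏ i, pMulSubst A F i) = 0
      · rw [hcu, mul_zero]
      · have hT := pcParam_mem_torusLocus_of_eval_ne_zero A F (c (Fin.last (s + 1))) hcu
        have h0 := hp _ ⟨_, ⟨pcParam_mem e P A F _ hc, hT⟩, projAdd_pcParam A F _ _ _⟩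
        change eval _ p = 0 at h0
        rw [h0, zero_mul]
    rw [vanishingIdeal_cyclicCoverBase hirr'] at hq
    have hPi : rename Fin.castSucc (∏ i, pMulSubst A F i) ∉
        Ideal.span {cyclicCoverPoly e (rename Fin.castSucc P)} := by
      intro hmem
      apply hU
      apply MvPolynomial.funext
      intro c2
      rw [map_zero]
      obtain ⟨t, ht⟩ := IsAlgClosed.exists_pow_nat_eq (eval (Fin.init c2) P) he
      have hc : (Fin.snoc (Fin.snoc (Fin.init c2) (c2 (Fin.last s)) : Fin (s + 1) → ℂ) t :
          Fin (s + 1 + 1) → ℂ) ∈ cyclicCoverBase e (rename Fin.castSucc P) := by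
        rw [snoc_snoc_mem_cyclicCoverBase_iff]
        exact ht
      have hvan : rename Fin.castSucc (∏ i, pMulSubst A F i) ∈
          vanishingIdeal ℂ (cyclicCoverBase e (rename Fin.castSucc P)) := by
        rw [vanishingIdeal_cyclicCoverBase hirr']
        exact hmem
      have h1 := (mem_vanishingIdeal_iff.1 hvan) _ hc
      change eval _ (rename Fin.castSucc (∏ i, pMulSubst A F i)) = 0 at h1
      rwa [eval_rename, snoc_comp_castSucc, Fin.snoc_init_self] at h1
    have hp' : rename (skipU s) p ∈ Ideal.span {cyclicCoverPoly e (rename Fin.castSucc P)} :=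
      (hprime.mem_or_mem hq).resolve_right hPi
    rw [mem_vanishingIdeal_iff]
    intro xf hxf
    have ht : xf (Fin.last s) ^ e = eval (Fin.init xf) P := by
      rw [mem_cyclicCoverBase_iff] at hxf
      exact hxf
    have hc : (Fin.snoc (Fin.snoc (Fin.init xf) 0 : Fin (s + 1) → ℂ) (xf (Fin.last s)) :
        Fin (s + 1 + 1) → ℂ) ∈ cyclicCoverBase e (rename Fin.castSucc P) := by
      rw [snoc_snoc_mem_cyclicCoverBase_iff]
      exact ht
    have hvan : rename (skipU s) p ∈ vanishingIdeal ℂ (cyclicCoverBase e (rename Fin.castSucc P)) := by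
      rw [vanishingIdeal_cyclicCoverBase hirr']
      exact hp'
    have h1 := (mem_vanishingIdeal_iff.1 hvan) _ hc
    change eval _ (rename (skipU s) p) = 0 at h1
    rw [eval_rename, snoc_snoc_comp_skipU, Fin.snoc_init_self] at h1
    exact h1
  · apply vanishingIdeal_anti_mono
    rintro _ ⟨z, ⟨hz, -⟩, rfl⟩
    exact projAdd_mem_cyclicCoverBase e P A F hz

/-- **`dim cl π(W ∩ Gⁿ) = s = n - 1`.** [folklore] -/
theorem addProjDim_polyFibredCover (he : 0 < e) (hirr : Irreducible (cyclicCoverPoly e P))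
    (hτ : Function.Injective (aeval (pMulSubst A F) :
      MvPolynomial (Fin (s + 1)) ℂ →ₐ[ℂ] MvPolynomial (Fin (s + 1)) ℂ)) :
    addProjDim ℂ (s + 1) (polyFibredCover e P A F) = (s : ℕ) := by
  have h := zariskiDim_cyclicCoverBase hirr
  unfold addProjDim
  unfold zariskiDim at h ⊢
  rw [vanishingIdeal_projAdd_polyFibredCover A F he hirr hτ]
  exact h

/-- **Periodicity of the base transfers**: `cl π(W ∩ Gⁿ)` has an integer period iff `B(e; P)` does
(same vanishing ideal). [folklore] -/
theorem hasIntegerPeriod_projAdd_polyFibredCover_iff (he : 0 < e)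
    (hirr : Irreducible (cyclicCoverPoly e P))
    (hτ : Function.Injective (aeval (pMulSubst A F) :
      MvPolynomial (Fin (s + 1)) ℂ →ₐ[ℂ] MvPolynomial (Fin (s + 1)) ℂ)) :
    HasIntegerPeriod ℂ (projAdd '' (polyFibredCover e P A F ∩ torusLocus ℂ (s + 1))) ↔
      HasIntegerPeriod ℂ (cyclicCoverBase e P) := by
  unfold HasIntegerPeriod
  rw [vanishingIdeal_projAdd_polyFibredCover A F he hirr hτ]

/-- **`W ∩ Gⁿ` is additively free** (`e ≥ 2`, irreducible cover, `τ` injective): an integer relation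
`Σ mᵢxᵢ = c` on `W ∩ Gⁿ` would vanish on all of `B(e; P)` (`vanishingIdeal_projAdd_polyFibredCover`);
`mₙ ≠ 0` is impossible since `P(x′) ≠ 0` has `e ≥ 2` distinct `e`-th roots, and `mₙ = 0` forces
`m′ = 0` because `B` surjects onto `ℂˢ`. [folklore] -/
theorem isAddFree_polyFibredCover (he : 2 ≤ e) (hirr : Irreducible (cyclicCoverPoly e P))
    (hτ : Function.Injective (aeval (pMulSubst A F) :
      MvPolynomial (Fin (s + 1)) ℂ →ₐ[ℂ] MvPolynomial (Fin (s + 1)) ℂ)) :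
    IsAddFree ℂ (s + 1) (polyFibredCover e P A F ∩ torusLocus ℂ (s + 1)) := by
  classical
  have he0 : 0 < e := by omega
  have hP : P ≠ 0 := ne_zero_of_irreducible_cyclicCoverPoly he hirr
  rintro m hm ⟨c, hc⟩
  -- the relation vanishes on the whole base
  set ℓ : MvPolynomial (Fin (s + 1)) ℂ := ∑ i, C ((m i : ℂ)) * X i - C c with hℓ
  have hℓeval : ∀ x : Fin (s + 1) → ℂ, eval x ℓ = ∑ i, (m i : ℂ) * x i - c := by
    intro x
    simp only [hℓ, map_sub, map_sum, map_mul, eval_C, eval_X]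
  have hℓmem : ℓ ∈ vanishingIdeal ℂ (projAdd '' (polyFibredCover e P A F ∩ torusLocus ℂ (s + 1))) := by
    rw [mem_vanishingIdeal_iff]
    rintro _ ⟨z, hz, rfl⟩
    change eval _ ℓ = 0
    rw [hℓeval, sub_eq_zero]
    simpa only [projAdd_apply] using hc z hz
  rw [vanishingIdeal_projAdd_polyFibredCover A F he0 hirr hτ, mem_vanishingIdeal_iff] at hℓmem
  have hvan : ∀ (x : Fin s → ℂ) (t : ℂ), t ^ e = eval x P →
      (m (Fin.last s) : ℂ) * t + ∑ j : Fin s, (m (Fin.castSucc j) : ℂ) * x j = c := by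
    intro x t ht
    have h1 := hℓmem _ ((snoc_mem_cyclicCoverBase_iff e P x t).2 ht)
    change eval _ ℓ = 0 at h1
    rw [hℓeval, sub_eq_zero, Fin.sum_univ_castSucc] at h1
    simp only [Fin.snoc_castSucc, Fin.snoc_last] at h1
    rw [← h1]
    ring
  by_cases hmn : m (Fin.last s) = 0
  · -- `m′ = 0` as well
    apply hm
    have hconst : ∀ x : Fin s → ℂ, ∑ j : Fin s, (m (Fin.castSucc j) : ℂ) * x j = c := by
      intro x
      obtain ⟨t, ht⟩ := IsAlgClosed.exists_pow_nat_eq (eval x P) he0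
      have := hvan x t ht
      rwa [hmn, Int.cast_zero, zero_mul, zero_add] at this
    have hc0 : c = 0 := by
      have := hconst 0
      simpa using this.symm
    funext i
    refine Fin.lastCases hmn (fun j => ?_) i
    have := hconst (Pi.single j 1)
    simp only [Pi.single_apply, mul_ite, mul_one, mul_zero, Finset.sum_ite_eq',
      Finset.mem_univ, if_true, hc0] at this
    exact_mod_cast this
  · -- two distinct roots over a point with `P(x′) ≠ 0`
    obtain ⟨x₀, hx₀⟩ : ∃ x₀ : Fin s → ℂ, eval x₀ P ≠ 0 := by
      by_contra hcon
      simp only [not_exists, not_not] at hcon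
      exact hP (MvPolynomial.funext fun x => by rw [hcon x, map_zero])
    obtain ⟨t₀, ht₀⟩ := IsAlgClosed.exists_pow_nat_eq (eval x₀ P) he0
    have ht₀0 : t₀ ≠ 0 := by
      rintro rfl
      exact hx₀ (by rw [← ht₀, zero_pow he0.ne'])
    have hprim := Complex.isPrimitiveRoot_exp e he0.ne'
    set ζ : ℂ := Complex.exp (2 * Real.pi * Complex.I / e)
    have hζ1 : ζ ≠ 1 := hprim.ne_one he
    have ht₁ : (t₀ * ζ) ^ e = eval x₀ P := by rw [mul_pow, hprim.pow_eq_one, mul_one, ht₀]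
    have h0 := hvan x₀ t₀ ht₀
    have h1 := hvan x₀ (t₀ * ζ) ht₁
    have h2 : (m (Fin.last s) : ℂ) * (t₀ * ζ - t₀) = 0 := by linear_combination h1 - h0
    rcases mul_eq_zero.1 h2 with h3 | h3
    · exact hmn (by exact_mod_cast h3)
    · apply hζ1
      have h4 : t₀ * (ζ - 1) = 0 := by linear_combination h3
      exact sub_eq_zero.1 ((mul_eq_zero.1 h4).resolve_left ht₀0)

/-- **The seven hypotheses of `ECCellAperiodic s`** for `W(e; P; A, F)` over an APERIODIC irreducible
cyclic cover (`e ≥ 2`, `τ` injective), in the order of the binders: irreducible closed,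
meets the torus, additively free (`isAddFree_polyFibredCover`), multiplicatively free,
`dim = s + 1`, `dim cl π = s`, base aperiodic. [folklore] -/
theorem ecCellAperiodic_hypotheses_polyFibredCover (he : 2 ≤ e)
    (hirr : Irreducible (cyclicCoverPoly e P))
    (hτ : Function.Injective (aeval (pMulSubst A F) :
      MvPolynomial (Fin (s + 1)) ℂ →ₐ[ℂ] MvPolynomial (Fin (s + 1)) ℂ))
    (haper : ¬ HasIntegerPeriod ℂ (cyclicCoverBase e P)) :
    IsIrreducibleClosed ℂ (polyFibredCover e P A F) ∧
      (polyFibredCover e P A F ∩ torusLocus ℂ (s + 1)).Nonempty ∧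
      IsAddFree ℂ (s + 1) (polyFibredCover e P A F ∩ torusLocus ℂ (s + 1)) ∧
      IsMulFree ℂ (s + 1) (polyFibredCover e P A F ∩ torusLocus ℂ (s + 1)) ∧
      zariskiDim ℂ (polyFibredCover e P A F) = (s + 1 : ℕ) ∧
      addProjDim ℂ (s + 1) (polyFibredCover e P A F) = s ∧
      ¬ HasIntegerPeriod ℂ (projAdd '' (polyFibredCover e P A F ∩ torusLocus ℂ (s + 1))) := by
  have he0 : 0 < e := by omega
  refine ⟨isIrreducibleClosed_polyFibredCover A F hirr,
    polyFibredCover_inter_torusLocus_nonempty A F he0 hτ, isAddFree_polyFibredCover A F he hirr hτ,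
    isMulFree_polyFibredCover A F he0 hτ, zariskiDim_polyFibredCover A F hirr,
    addProjDim_polyFibredCover A F he0 hirr hτ, ?_⟩
  rw [hasIntegerPeriod_projAdd_polyFibredCover_iff A F he0 hirr hτ]
  exact haper

/-- **Exponential points from `ECCellAperiodic s`** for such `W`. [folklore] -/
theorem polyFibredCover_inter_expGraph_nonempty_of_ecCellAperiodic (h : ECCellAperiodic s)
    (he : 2 ≤ e) (hirr : Irreducible (cyclicCoverPoly e P))
    (hτ : Function.Injective (aeval (pMulSubst A F) :
      MvPolynomial (Fin (s + 1)) ℂ →ₐ[ℂ] MvPolynomial (Fin (s + 1)) ℂ))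
    (haper : ¬ HasIntegerPeriod ℂ (cyclicCoverBase e P)) :
    (polyFibredCover e P A F ∩ expGraph ℂ (s + 1)).Nonempty := by
  obtain ⟨h1, h2, h3, h4, h5, h6, h7⟩ :=
    ecCellAperiodic_hypotheses_polyFibredCover A F he hirr hτ haper
  exact h _ h1 h2 h3 h4 h5 h6 h7

/-- **The eight hypotheses of `ECCellPeriodic s`** for `W(e; P; A, F)` over a PERIODIC irreducible
cyclic cover (`e ≥ 2`, `τ` injective): here rotundity comes from the dominant multiplicative
projection and additive freeness from `isAddFree_polyFibredCover`. [folklore] -/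
theorem ecCellPeriodic_hypotheses_polyFibredCover (he : 2 ≤ e)
    (hirr : Irreducible (cyclicCoverPoly e P))
    (hτ : Function.Injective (aeval (pMulSubst A F) :
      MvPolynomial (Fin (s + 1)) ℂ →ₐ[ℂ] MvPolynomial (Fin (s + 1)) ℂ))
    (hper : HasIntegerPeriod ℂ (cyclicCoverBase e P)) :
    IsIrreducibleClosed ℂ (polyFibredCover e P A F) ∧
      (polyFibredCover e P A F ∩ torusLocus ℂ (s + 1)).Nonempty ∧
      IsRotund ℂ (s + 1) (polyFibredCover e P A F ∩ torusLocus ℂ (s + 1)) ∧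
      IsAddFree ℂ (s + 1) (polyFibredCover e P A F ∩ torusLocus ℂ (s + 1)) ∧
      IsMulFree ℂ (s + 1) (polyFibredCover e P A F ∩ torusLocus ℂ (s + 1)) ∧
      zariskiDim ℂ (polyFibredCover e P A F) = (s + 1 : ℕ) ∧
      addProjDim ℂ (s + 1) (polyFibredCover e P A F) = s ∧
      HasIntegerPeriod ℂ (projAdd '' (polyFibredCover e P A F ∩ torusLocus ℂ (s + 1))) := by
  have he0 : 0 < e := by omega
  refine ⟨isIrreducibleClosed_polyFibredCover A F hirr,
    polyFibredCover_inter_torusLocus_nonempty A F he0 hτ, isRotund_polyFibredCover A F he0 hirr hτ,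
    isAddFree_polyFibredCover A F he hirr hτ, isMulFree_polyFibredCover A F he0 hτ,
    zariskiDim_polyFibredCover A F hirr, addProjDim_polyFibredCover A F he0 hirr hτ, ?_⟩
  rw [hasIntegerPeriod_projAdd_polyFibredCover_iff A F he0 hirr hτ]
  exact hper

/-- **Exponential points from `ECCellPeriodic s`.** [folklore] -/
theorem polyFibredCover_inter_expGraph_nonempty_of_ecCellPeriodic (h : ECCellPeriodic s)
    (he : 2 ≤ e) (hirr : Irreducible (cyclicCoverPoly e P))
    (hτ : Function.Injective (aeval (pMulSubst A F) :
      MvPolynomial (Fin (s + 1)) ℂ →ₐ[ℂ] MvPolynomial (Fin (s + 1)) ℂ))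
    (hper : HasIntegerPeriod ℂ (cyclicCoverBase e P)) :
    (polyFibredCover e P A F ∩ expGraph ℂ (s + 1)).Nonempty := by
  obtain ⟨h1, h2, h3, h4, h5, h6, h7, h8⟩ :=
    ecCellPeriodic_hypotheses_polyFibredCover A F he hirr hτ hper
  exact h _ h1 h2 h3 h4 h5 h6 h7 h8

/-- **The seven hypotheses of the cell `ECCell (s + 1) s` itself** (no periodicity case split).
[folklore] -/
theorem ecCell_hypotheses_polyFibredCover (he : 2 ≤ e) (hirr : Irreducible (cyclicCoverPoly e P))
    (hτ : Function.Injective (aeval (pMulSubst A F) :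
      MvPolynomial (Fin (s + 1)) ℂ →ₐ[ℂ] MvPolynomial (Fin (s + 1)) ℂ)) :
    IsIrreducibleClosed ℂ (polyFibredCover e P A F) ∧
      (polyFibredCover e P A F ∩ torusLocus ℂ (s + 1)).Nonempty ∧
      IsRotund ℂ (s + 1) (polyFibredCover e P A F ∩ torusLocus ℂ (s + 1)) ∧
      IsAddFree ℂ (s + 1) (polyFibredCover e P A F ∩ torusLocus ℂ (s + 1)) ∧
      IsMulFree ℂ (s + 1) (polyFibredCover e P A F ∩ torusLocus ℂ (s + 1)) ∧
      zariskiDim ℂ (polyFibredCover e P A F) = (s + 1 : ℕ) ∧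
      addProjDim ℂ (s + 1) (polyFibredCover e P A F) = s := by
  have he0 : 0 < e := by omega
  exact ⟨isIrreducibleClosed_polyFibredCover A F hirr,
    polyFibredCover_inter_torusLocus_nonempty A F he0 hτ, isRotund_polyFibredCover A F he0 hirr hτ,
    isAddFree_polyFibredCover A F he hirr hτ, isMulFree_polyFibredCover A F he0 hτ,
    zariskiDim_polyFibredCover A F hirr, addProjDim_polyFibredCover A F he0 hirr hτ⟩

/-- **Exponential points from `ECCell (s + 1) s`.** [folklore] -/
theorem polyFibredCover_inter_expGraph_nonempty_of_ecCell (h : ECCell (s + 1) s) (he : 2 ≤ e)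
    (hirr : Irreducible (cyclicCoverPoly e P))
    (hτ : Function.Injective (aeval (pMulSubst A F) :
      MvPolynomial (Fin (s + 1)) ℂ →ₐ[ℂ] MvPolynomial (Fin (s + 1)) ℂ)) :
    (polyFibredCover e P A F ∩ expGraph ℂ (s + 1)).Nonempty := by
  obtain ⟨h1, h2, h3, h4, h5, h6, h7⟩ := ecCell_hypotheses_polyFibredCover A F he hirr hτ
  exact h _ h1 h2 h3 h4 h5 h6 h7

variable (e P)

/-- **System dictionary**: `W(e; P; A, F)` meets the graph of `exp` iff the system
`t^e = P(x′)`, `e^{xⱼ} = Aⱼ(x′) + e^t Fⱼ(e^t, x′)` (`j ≤ s`) has a solution. [folklore] -/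
theorem polyFibredCover_inter_expGraph_nonempty_iff :
    (polyFibredCover e P A F ∩ expGraph ℂ (s + 1)).Nonempty ↔
      ∃ (x : Fin s → ℂ) (t : ℂ), t ^ e = eval x P ∧
        ∀ j, Complex.exp (x j) = eval x (A j) +
          Complex.exp t * eval (Fin.cons (Complex.exp t) x : Fin (s + 1) → ℂ) (F j) := by
  constructor
  · rintro ⟨z, hz, hΓ⟩
    rw [mem_expGraph_iff] at hΓ
    simp only [Literature.ModelTheory.ExponentialFields.ExponentialRing.complex_exp_eq] at hΓ
    refine ⟨fun j => z (Sum.inl (Fin.castSucc j)), z (Sum.inl (Fin.last s)), hz.1, fun j => ?_⟩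
    have h2 := hz.2 j
    rw [hΓ (Fin.castSucc j), hΓ (Fin.last s)] at h2
    exact h2
  · rintro ⟨x, t, ht, hsys⟩
    refine ⟨Sum.elim (Fin.snoc x t : Fin (s + 1) → ℂ)
      (fun i => Complex.exp ((Fin.snoc x t : Fin (s + 1) → ℂ) i)), ⟨?_, fun j => ?_⟩, fun i => ?_⟩
    · simp only [Sum.elim_inl, Fin.snoc_last, Fin.snoc_castSucc]
      exact ht
    · simp only [Sum.elim_inl, Sum.elim_inr, Fin.snoc_castSucc, Fin.snoc_last]
      exact hsys j
    · simp [Literature.ModelTheory.ExponentialFields.ExponentialRing.complex_exp_eq]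

end FibredCover

/-! ### The problem side's quadric-cover shape and the hyperboloid model, certified -/

section HyperboloidModel

variable {s : ℕ}

/-- The set of `ZilberEacComplexQuadricCoverExamples.quadricCover_inter_expGraph_nonempty`
VERBATIM: `xₙ² = P(x′)`, `yⱼ = Aⱼ(x′) + yₙ Fⱼ(yₙ)` with `Fⱼ ∈ ℂ[u]` univariate. [folklore] -/
def quadricCoverVariety (P : MvPolynomial (Fin s) ℂ) (A : Fin s → MvPolynomial (Fin s) ℂ)
    (F : Fin s → Polynomial ℂ) : Set (Fin (s + 1) ⊕ Fin (s + 1) → ℂ) :=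
  {z | z (Sum.inl (Fin.last s)) ^ 2 = eval (fun j => z (Sum.inl (Fin.castSucc j))) P ∧
    ∀ j : Fin s, z (Sum.inr (Fin.castSucc j)) =
      eval (fun i => z (Sum.inl (Fin.castSucc i))) (A j) +
        z (Sum.inr (Fin.last s)) * (F j).eval (z (Sum.inr (Fin.last s)))}

/-- It is the poly-fibred double cover with fibres `Fⱼ(u)` read in `ℂ[u, x′]`. [folklore] -/
theorem quadricCoverVariety_eq_polyFibredCover (P : MvPolynomial (Fin s) ℂ)
    (A : Fin s → MvPolynomial (Fin s) ℂ) (F : Fin s → Polynomial ℂ) :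
    quadricCoverVariety P A F =
      polyFibredCover 2 P A (fun j => Polynomial.aeval (X 0 : MvPolynomial (Fin (s + 1)) ℂ) (F j)) := by
  ext z
  rw [mem_polyFibredCover_iff]
  simp only [quadricCoverVariety, Set.mem_setOf_eq]
  refine and_congr_right fun _ => forall_congr' fun j => ?_
  have hF : eval (Fin.cons (z (Sum.inr (Fin.last s))) fun i => z (Sum.inl (Fin.castSucc i)))
      (Polynomial.aeval (X 0 : MvPolynomial (Fin (s + 1)) ℂ) (F j)) =
        (F j).eval (z (Sum.inr (Fin.last s))) := by
    change aeval (Fin.cons (z (Sum.inr (Fin.last s))) fun i => z (Sum.inl (Fin.castSucc i)))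
      (Polynomial.aeval (X 0 : MvPolynomial (Fin (s + 1)) ℂ) (F j)) = _
    rw [← Polynomial.aeval_algHom_apply, aeval_X, Fin.cons_zero, Polynomial.coe_aeval_eq_eval]
  rw [hF]

/-- So the quadric-cover systems are certified members of the (sub-)cells whenever `xₙ² - P` is
irreducible and `τ` injective — e.g. (`aeval_pMulSubst_injective`) whenever `A` is dominant.
[folklore] -/
theorem ecCell_hypotheses_quadricCoverVariety (P : MvPolynomial (Fin s) ℂ)
    (A : Fin s → MvPolynomial (Fin s) ℂ) (F : Fin s → Polynomial ℂ)
    (hirr : Irreducible (cyclicCoverPoly 2 P))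
    (hA : Function.Injective (aeval A : MvPolynomial (Fin s) ℂ →ₐ[ℂ] MvPolynomial (Fin s) ℂ)) :
    IsIrreducibleClosed ℂ (quadricCoverVariety P A F) ∧
      (quadricCoverVariety P A F ∩ torusLocus ℂ (s + 1)).Nonempty ∧
      IsRotund ℂ (s + 1) (quadricCoverVariety P A F ∩ torusLocus ℂ (s + 1)) ∧
      IsAddFree ℂ (s + 1) (quadricCoverVariety P A F ∩ torusLocus ℂ (s + 1)) ∧
      IsMulFree ℂ (s + 1) (quadricCoverVariety P A F ∩ torusLocus ℂ (s + 1)) ∧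
      zariskiDim ℂ (quadricCoverVariety P A F) = (s + 1 : ℕ) ∧
      addProjDim ℂ (s + 1) (quadricCoverVariety P A F) = s := by
  rw [quadricCoverVariety_eq_polyFibredCover]
  exact ecCell_hypotheses_polyFibredCover _ _ le_rfl hirr (aeval_pMulSubst_injective _ _ hA)

/-- **The hyperboloid 3-fold** `V_H = {x₃² = x₁² + x₂² + 1, y₁ = x₁ + y₃, y₂ = x₂ - y₃}` of the
problem side's `hyperboloid_model_system_solvable` (`ZilberEacComplexQuadricCoverExamples`).
[folklore] -/
def hyperboloidFibredModel : Set (Fin 3 ⊕ Fin 3 → ℂ) :=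
  polyFibredCover 2 (X 0 ^ 2 + X 1 ^ 2 + 1 : MvPolynomial (Fin 2) ℂ) (fun j => X j) ![1, -1]

/-- `x₁² + x₂² + 1 ∈ ℂ[x₁, x₂]` is irreducible: it is the double cover `x₂² = -(x₁² + 1)` of the line,
Eisenstein at the simple prime factor `x₁ + i` of `-(x₁ + i)(x₁ - i)`. [folklore] -/
theorem irreducible_sumSq_add_one :
    Irreducible (X 0 ^ 2 + X 1 ^ 2 + 1 : MvPolynomial (Fin 2) ℂ) := by
  have hπirr : Irreducible (X 0 + C Complex.I : MvPolynomial (Fin 1) ℂ) := by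
    have h := irreducible_transl (w := fun _ : Fin 1 => Complex.I)
      (MvPolynomial.X_prime : Prime (X (0 : Fin 1) : MvPolynomial (Fin 1) ℂ)).irreducible
    rwa [transl_X] at h
  have hπ : Prime (X 0 + C Complex.I : MvPolynomial (Fin 1) ℂ) :=
    UniqueFactorizationMonoid.irreducible_iff_prime.1 hπirr
  have hI : (C Complex.I : MvPolynomial (Fin 1) ℂ) * C Complex.I = -1 := by
    rw [← C_mul, Complex.I_mul_I, C_neg, C_1]
  have hfac : (X 0 + C Complex.I : MvPolynomial (Fin 1) ℂ) * (-(X 0 - C Complex.I)) =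
      -(X 0 ^ 2 + 1) := by
    linear_combination hI
  have hdvd : (X 0 + C Complex.I : MvPolynomial (Fin 1) ℂ) ∣ -(X 0 ^ 2 + 1) := ⟨_, hfac.symm⟩
  have hndvd : ¬ (X 0 + C Complex.I : MvPolynomial (Fin 1) ℂ) ^ 2 ∣ -(X 0 ^ 2 + 1) := by
    rintro ⟨q, hq⟩
    have h1 : (X 0 + C Complex.I : MvPolynomial (Fin 1) ℂ) * ((X 0 + C Complex.I) * q) =
        (X 0 + C Complex.I) * (-(X 0 - C Complex.I)) := by
      rw [← mul_assoc, ← pow_two, ← hq, hfac]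
    have h2 := mul_left_cancel₀ hπ.ne_zero h1
    have h3 := congrArg (eval fun _ : Fin 1 => -Complex.I) h2
    simp only [map_mul, map_add, map_neg, map_sub, eval_X, eval_C, neg_add_cancel, zero_mul] at h3
    have h4 : (2 : ℂ) * Complex.I = 0 := by linear_combination -h3
    exact Complex.I_ne_zero ((mul_eq_zero.1 h4).resolve_left two_ne_zero)
  have h := irreducible_cyclicCoverPoly (s := 1) (e := 2) (by norm_num) hπ hdvd hndvd
  have heq : cyclicCoverPoly 2 (-(X 0 ^ 2 + 1) : MvPolynomial (Fin 1) ℂ) =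
      (X 0 ^ 2 + X 1 ^ 2 + 1 : MvPolynomial (Fin 2) ℂ) := by
    simp only [cyclicCoverPoly, map_neg, map_add, map_pow, map_one, rename_X]
    have h0 : (Fin.castSucc (0 : Fin 1) : Fin 2) = 0 := rfl
    have h1 : (Fin.last 1 : Fin 2) = 1 := rfl
    rw [h0, h1]
    ring
  rwa [heq] at h

/-- Its base is the hyperboloid `hyperboloidModelBase` (`t² = z² + w² + 1`). [folklore] -/
theorem cyclicCoverBase_sumSq_add_one :
    cyclicCoverBase 2 (X 0 ^ 2 + X 1 ^ 2 + 1 : MvPolynomial (Fin 2) ℂ) = hyperboloidModelBase := by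
  ext x
  rw [mem_cyclicCoverBase_iff]
  simp only [hyperboloidModelBase, Set.mem_setOf_eq, map_add, map_pow, map_one, eval_X]
  have h2 : (Fin.last 2) = (2 : Fin 3) := rfl
  have h0 : (Fin.castSucc (0 : Fin 2)) = (0 : Fin 3) := rfl
  have h1 : (Fin.castSucc (1 : Fin 2)) = (1 : Fin 3) := rfl
  rw [h2, h0, h1]

/-- **The hyperboloid 3-fold is a certified member of the rotundity-free sub-cell `ECCellAperiodic 2`**:
irreducible double cover (`irreducible_sumSq_add_one`), `τ` injective (offsets `A = (x₁, x₂)` = the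
identity, dominant), base aperiodic (`not_hasIntegerPeriod_hyperboloidModelBase`). The first
certified member over a NON-graph base. [folklore] -/
theorem ecCellAperiodic_hypotheses_hyperboloidFibredModel :
    IsIrreducibleClosed ℂ hyperboloidFibredModel ∧
      (hyperboloidFibredModel ∩ torusLocus ℂ 3).Nonempty ∧
      IsAddFree ℂ 3 (hyperboloidFibredModel ∩ torusLocus ℂ 3) ∧
      IsMulFree ℂ 3 (hyperboloidFibredModel ∩ torusLocus ℂ 3) ∧
      zariskiDim ℂ hyperboloidFibredModel = (3 : ℕ) ∧
      addProjDim ℂ 3 hyperboloidFibredModel = 2 ∧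
      ¬ HasIntegerPeriod ℂ (projAdd '' (hyperboloidFibredModel ∩ torusLocus ℂ 3)) := by
  have hA : Function.Injective (aeval (fun j : Fin 2 => (X j : MvPolynomial (Fin 2) ℂ)) :
      MvPolynomial (Fin 2) ℂ →ₐ[ℂ] MvPolynomial (Fin 2) ℂ) := by
    rw [show (fun j : Fin 2 => (X j : MvPolynomial (Fin 2) ℂ)) = X from rfl, aeval_X_left]
    exact fun _ _ h => h
  have haper : ¬ HasIntegerPeriod ℂ
      (cyclicCoverBase 2 (X 0 ^ 2 + X 1 ^ 2 + 1 : MvPolynomial (Fin 2) ℂ)) := by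
    rw [cyclicCoverBase_sumSq_add_one]
    exact not_hasIntegerPeriod_hyperboloidModelBase
  exact ecCellAperiodic_hypotheses_polyFibredCover _ _ le_rfl
    (irreducible_cyclicCoverPoly_of_irreducible (by norm_num) irreducible_sumSq_add_one)
    (aeval_pMulSubst_injective _ _ hA) haper

/-- **`ECCellAperiodic 2` gives an exponential point on the hyperboloid 3-fold.** [folklore] -/
theorem hyperboloidFibredModel_inter_expGraph_nonempty_of_ecCellAperiodic (h : ECCellAperiodic 2) :
    (hyperboloidFibredModel ∩ expGraph ℂ 3).Nonempty := by
  obtain ⟨h1, h2, h3, h4, h5, h6, h7⟩ := ecCellAperiodic_hypotheses_hyperboloidFibredModel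
  exact h _ h1 h2 h3 h4 h5 h6 h7

/-- **System dictionary, verbatim the problem side's `hyperboloid_model_system_solvable`**: the
hyperboloid 3-fold meets the graph of `exp` iff `∃ z w t, t² = z² + w² + 1 ∧ e^z = z + e^t ∧
e^w = w - e^t`. [folklore] -/
theorem hyperboloidFibredModel_inter_expGraph_nonempty_iff :
    (hyperboloidFibredModel ∩ expGraph ℂ 3).Nonempty ↔
      ∃ z w t : ℂ, t ^ 2 = z ^ 2 + w ^ 2 + 1 ∧ Complex.exp z = z + Complex.exp t ∧
        Complex.exp w = w - Complex.exp t := by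
  rw [hyperboloidFibredModel, polyFibredCover_inter_expGraph_nonempty_iff]
  constructor
  · rintro ⟨x, t, ht, hsys⟩
    refine ⟨x 0, x 1, t, ?_, ?_, ?_⟩
    · simpa [map_add, map_pow, eval_X] using ht
    · have := hsys 0
      simpa using this
    · have := hsys 1
      simp at this
      linear_combination this
  · rintro ⟨z, w, t, ht, hz, hw⟩
    refine ⟨![z, w], t, ?_, fun j => ?_⟩
    · simpa [map_add, map_pow, eval_X] using ht
    · fin_cases j
      · simpa using hz
      · simp
        linear_combination hw

end HyperboloidModel

/-! ### Sphere double covers `Σ xᵢ² = r` with polynomial fibres, certified for every `r` -/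

section SphereCovers

variable {s : ℕ}

/-- Evaluating a univariate fibre read in `ℂ[u, x′]` (variable `0` = `u`). [folklore] -/
theorem eval_polynomial_aeval_X_zero (c : Fin (s + 1) → ℂ) (f : Polynomial ℂ) :
    eval c (Polynomial.aeval (X 0 : MvPolynomial (Fin (s + 1)) ℂ) f) = f.eval (c 0) := by
  change aeval c (Polynomial.aeval (X 0 : MvPolynomial (Fin (s + 1)) ℂ) f) = _
  rw [← Polynomial.aeval_algHom_apply, aeval_X, Polynomial.coe_aeval_eq_eval]

/-- **System dictionary for the quadric-cover shape, verbatim the conclusion of the problem side's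
`exists_solution_quadricCover`**: `V ∩ Γ_exp ≠ ∅ ↔ ∃ x′ xₙ, xₙ² = P(x′) ∧ ∀ j, e^{xⱼ} = Aⱼ(x′) +
e^{xₙ} Fⱼ(e^{xₙ})`. [folklore] -/
theorem quadricCoverVariety_inter_expGraph_nonempty_iff (P : MvPolynomial (Fin s) ℂ)
    (A : Fin s → MvPolynomial (Fin s) ℂ) (F : Fin s → Polynomial ℂ) :
    (quadricCoverVariety P A F ∩ expGraph ℂ (s + 1)).Nonempty ↔
      ∃ x : Fin s → ℂ, ∃ xn : ℂ, xn ^ 2 = eval x P ∧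
        ∀ j, Complex.exp (x j) = eval x (A j) + Complex.exp xn * (F j).eval (Complex.exp xn) := by
  rw [quadricCoverVariety_eq_polyFibredCover, polyFibredCover_inter_expGraph_nonempty_iff]
  refine exists_congr fun x => exists_congr fun t => and_congr Iff.rfl (forall_congr' fun j => ?_)
  rw [eval_polynomial_aeval_X_zero, Fin.cons_zero]

/-- `spherePoly s r = r - Σ_{i ≤ s} Xᵢ² ∈ ℂ[x₁, …, x_{s+1}]`; the double cover
`x_{s+2}² = spherePoly s r` is the complex sphere `Σ_{i ≤ s+1} xᵢ² = r` (gen 6's `sphereBase s r`).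
[folklore] -/
noncomputable def spherePoly (s : ℕ) (r : ℂ) : MvPolynomial (Fin (s + 1)) ℂ := C r - ∑ i, X i ^ 2

/-- The double cover of `spherePoly` is the sphere. [folklore] -/
theorem cyclicCoverBase_spherePoly (r : ℂ) :
    cyclicCoverBase 2 (spherePoly s r) = sphereBase s r := by
  ext x
  rw [mem_cyclicCoverBase_iff]
  simp only [sphereBase, Set.mem_setOf_eq, spherePoly, map_sub, map_sum, map_pow, eval_C, eval_X]
  rw [Fin.sum_univ_castSucc (f := fun i : Fin (s + 1 + 1) => x i ^ 2)]
  constructor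
  · intro h
    linear_combination h
  · intro h
    linear_combination h

/-- `x_{s+2}² - spherePoly s r˜ = -(spherePoly (s + 1) r) = Σ_{i ≤ s+1} Xᵢ² - r`. [folklore] -/
theorem cyclicCoverPoly_spherePoly (r : ℂ) :
    cyclicCoverPoly 2 (spherePoly s r) = -spherePoly (s + 1) r := by
  simp only [cyclicCoverPoly, spherePoly, map_sub, map_sum, map_pow, rename_C, rename_X]
  rw [Fin.sum_univ_castSucc (f := fun i : Fin (s + 1 + 1) => (X i : MvPolynomial (Fin (s + 1 + 1)) ℂ) ^ 2)]
  ring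

/-- The sphere polynomial of gen 6 (`sphereBase_eq_zeroLocus`) is `-spherePoly`. [folklore] -/
theorem sumSq_sub_C_eq_neg_spherePoly (r : ℂ) :
    (∑ i, X i ^ 2 - C r : MvPolynomial (Fin (s + 2)) ℂ) = -spherePoly (s + 1) r := by
  rw [spherePoly, neg_sub]

/-- `X₀ + i X₁` is prime in `ℂ[X₀, X₁]` (it is a coordinate after a linear change of variables).
[folklore] -/
theorem prime_X_zero_add_I_mul_X_one :
    Prime (X 0 + C Complex.I * X 1 : MvPolynomial (Fin 2) ℂ) := by
  let f : Fin 2 → MvPolynomial (Fin 2) ℂ := ![X 0 + C Complex.I * X 1, X 1]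
  let g : Fin 2 → MvPolynomial (Fin 2) ℂ := ![X 0 - C Complex.I * X 1, X 1]
  have hfg : (aeval f).comp (aeval g) = AlgHom.id ℂ (MvPolynomial (Fin 2) ℂ) := by
    apply MvPolynomial.algHom_ext
    intro i
    fin_cases i
    · simp [f, g]
    · simp [f, g]
  have hgf : (aeval g).comp (aeval f) = AlgHom.id ℂ (MvPolynomial (Fin 2) ℂ) := by
    apply MvPolynomial.algHom_ext
    intro i
    fin_cases i
    · simp [f, g]
    · simp [f, g]
  let φ : MvPolynomial (Fin 2) ℂ ≃ₐ[ℂ] MvPolynomial (Fin 2) ℂ := AlgEquiv.ofAlgHom _ _ hfg hgf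
  have hφ : φ (X 0) = X 0 + C Complex.I * X 1 := by
    show aeval f (X 0) = _
    rw [aeval_X]
    rfl
  rw [← hφ]
  exact (MulEquiv.prime_iff φ).2 (MvPolynomial.X_prime : Prime (X (0 : Fin 2) : MvPolynomial (Fin 2) ℂ))

/-- **`x_{s+2}² - spherePoly s r = Σ_{i ≤ s+1} xᵢ² - r` is irreducible** for every `r` when `s ≥ 1`
(at least three squares) and for `r ≠ 0` when `s = 0` (the conic `x₁² + x₂² = r`); by induction
on `s`, Eisenstein at a simple prime factor of `spherePoly`: `x₁ + a` (`a² = r ≠ 0`),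
`x₁ + i x₂` (`s = 1`, `r = 0`), or the irreducible `spherePoly` one dimension down. [folklore] -/
theorem irreducible_cyclicCoverPoly_spherePoly :
    ∀ (s : ℕ) (r : ℂ), (s ≠ 0 ∨ r ≠ 0) → Irreducible (cyclicCoverPoly 2 (spherePoly s r))
  | 0, r, h => by
    have hr : r ≠ 0 := h.resolve_left fun h0 => h0 rfl
    obtain ⟨a, ha⟩ := IsAlgClosed.exists_pow_nat_eq r (by norm_num : 0 < 2)
    have ha0 : a ≠ 0 := by
      rintro rfl
      exact hr (by rw [← ha, zero_pow two_ne_zero])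
    have hπirr : Irreducible (X 0 + C a : MvPolynomial (Fin 1) ℂ) := by
      have h1 := irreducible_transl (w := fun _ : Fin 1 => a)
        (MvPolynomial.X_prime : Prime (X (0 : Fin 1) : MvPolynomial (Fin 1) ℂ)).irreducible
      rwa [transl_X] at h1
    have hπ : Prime (X 0 + C a : MvPolynomial (Fin 1) ℂ) :=
      UniqueFactorizationMonoid.irreducible_iff_prime.1 hπirr
    have hsph : spherePoly 0 r = (X 0 + C a) * (-(X 0 - C a)) := by
      rw [spherePoly, Fin.sum_univ_one, ← ha, C_pow]
      ring
    have hdvd : (X 0 + C a : MvPolynomial (Fin 1) ℂ) ∣ spherePoly 0 r := ⟨_, hsph⟩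
    have hndvd : ¬ (X 0 + C a : MvPolynomial (Fin 1) ℂ) ^ 2 ∣ spherePoly 0 r := by
      rintro ⟨q, hq⟩
      have h1 : (X 0 + C a : MvPolynomial (Fin 1) ℂ) * ((X 0 + C a) * q) =
          (X 0 + C a) * (-(X 0 - C a)) := by
        rw [← mul_assoc, ← pow_two, ← hq, hsph]
      have h2 := mul_left_cancel₀ hπ.ne_zero h1
      have h3 := congrArg (eval fun _ : Fin 1 => -a) h2
      simp only [map_mul, map_add, map_neg, map_sub, eval_X, eval_C, neg_add_cancel, zero_mul] at h3
      have h4 : (2 : ℂ) * a = 0 := by linear_combination -h3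
      exact ha0 ((mul_eq_zero.1 h4).resolve_left two_ne_zero)
    exact irreducible_cyclicCoverPoly (by norm_num) hπ hdvd hndvd
  | (k + 1), r, _ => by
    by_cases hk : k ≠ 0 ∨ r ≠ 0
    · have hprime : Prime (cyclicCoverPoly 2 (spherePoly k r)) :=
        UniqueFactorizationMonoid.irreducible_iff_prime.1
          (irreducible_cyclicCoverPoly_spherePoly k r hk)
      have hP : spherePoly (k + 1) r = -cyclicCoverPoly 2 (spherePoly k r) := by
        rw [cyclicCoverPoly_spherePoly, neg_neg]
      refine irreducible_cyclicCoverPoly (by norm_num) hprime ?_ ?_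
      · rw [hP]
        exact dvd_neg.2 dvd_rfl
      · rw [hP]
        rintro ⟨q, hq⟩
        apply hprime.not_unit
        have h1 : cyclicCoverPoly 2 (spherePoly k r) * (cyclicCoverPoly 2 (spherePoly k r) * q) =
            cyclicCoverPoly 2 (spherePoly k r) * (-1) := by
          rw [← mul_assoc, ← pow_two, ← hq, mul_neg_one]
        have h2 := mul_left_cancel₀ hprime.ne_zero h1
        exact isUnit_iff_exists_inv.2 ⟨-q, by rw [mul_neg, h2, neg_neg]⟩
    · -- `k = 0`, `r = 0`: `spherePoly 1 0 = -(X₀² + X₁²) = (X₀ + iX₁) · (-(X₀ - iX₁))`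
      simp only [not_or, not_not] at hk
      obtain ⟨rfl, rfl⟩ := hk
      have hI : (C Complex.I : MvPolynomial (Fin (0 + 1 + 1)) ℂ) * C Complex.I = -1 := by
        rw [← C_mul, Complex.I_mul_I, C_neg, C_1]
      have hsph : spherePoly (0 + 1) 0 =
          (X 0 + C Complex.I * X 1) * (-(X 0 - C Complex.I * X 1)) := by
        rw [spherePoly, Fin.sum_univ_two, C_0]
        linear_combination (-(X 1 : MvPolynomial (Fin (0 + 1 + 1)) ℂ) ^ 2) * hI
      have hπ : Prime (X 0 + C Complex.I * X 1 : MvPolynomial (Fin (0 + 1 + 1)) ℂ) :=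
        prime_X_zero_add_I_mul_X_one
      have hdvd : (X 0 + C Complex.I * X 1 : MvPolynomial (Fin (0 + 1 + 1)) ℂ) ∣ spherePoly (0 + 1) 0 :=
        ⟨_, hsph⟩
      have hndvd : ¬ (X 0 + C Complex.I * X 1 : MvPolynomial (Fin (0 + 1 + 1)) ℂ) ^ 2 ∣
          spherePoly (0 + 1) 0 := by
        rintro ⟨q, hq⟩
        have h1 : (X 0 + C Complex.I * X 1 : MvPolynomial (Fin (0 + 1 + 1)) ℂ) *
            ((X 0 + C Complex.I * X 1) * q) =
              (X 0 + C Complex.I * X 1) * (-(X 0 - C Complex.I * X 1)) := by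
          rw [← mul_assoc, ← pow_two, ← hq, hsph]
        have h2 := mul_left_cancel₀ hπ.ne_zero h1
        have h3 := congrArg (eval ![1, Complex.I]) h2
        simp only [map_mul, map_add, map_neg, map_sub, eval_X, eval_C, Matrix.cons_val_zero,
          Matrix.cons_val_one] at h3
        have h4 : (1 : ℂ) + Complex.I * Complex.I = 0 := by
          rw [Complex.I_mul_I, add_neg_cancel]
        rw [h4, zero_mul, Complex.I_mul_I] at h3
        norm_num at h3
      exact irreducible_cyclicCoverPoly (by norm_num) hπ hdvd hndvd

/-- **`Σ_{i ≤ s+1} Xᵢ² - r ∈ ℂ[x₁, …, x_{s+2}]` is irreducible** unless `s = 0` and `r = 0`.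
[folklore] -/
theorem irreducible_sumSq_sub_C (r : ℂ) (h : s ≠ 0 ∨ r ≠ 0) :
    Irreducible (∑ i, X i ^ 2 - C r : MvPolynomial (Fin (s + 2)) ℂ) := by
  rw [sumSq_sub_C_eq_neg_spherePoly, ← cyclicCoverPoly_spherePoly]
  exact irreducible_cyclicCoverPoly_spherePoly s r h

/-- The excluded case is genuinely reducible: `X₀² + X₁² = (X₀ + iX₁)(X₀ - iX₁)`. [folklore] -/
theorem not_irreducible_X_sq_add_X_sq :
    ¬ Irreducible (X 0 ^ 2 + X 1 ^ 2 : MvPolynomial (Fin 2) ℂ) := by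
  have hI : (C Complex.I : MvPolynomial (Fin 2) ℂ) * C Complex.I = -1 := by
    rw [← C_mul, Complex.I_mul_I, C_neg, C_1]
  have hfac : (X 0 ^ 2 + X 1 ^ 2 : MvPolynomial (Fin 2) ℂ) =
      (X 0 + C Complex.I * X 1) * (X 0 - C Complex.I * X 1) := by
    linear_combination (X 1 : MvPolynomial (Fin 2) ℂ) ^ 2 * hI
  intro h
  rcases h.isUnit_or_isUnit hfac with hu | hu
  · have h1 := hu.map (eval ![1, Complex.I])
    simp only [map_add, map_mul, eval_X, eval_C, Matrix.cons_val_zero, Matrix.cons_val_one,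
      Complex.I_mul_I, add_neg_cancel, isUnit_zero_iff] at h1
    exact zero_ne_one h1
  · have h1 := hu.map (eval ![1, -Complex.I])
    simp only [map_sub, map_mul, eval_X, eval_C, Matrix.cons_val_zero, Matrix.cons_val_one,
      mul_neg, Complex.I_mul_I, neg_neg, sub_self, isUnit_zero_iff] at h1
    exact zero_ne_one h1

/-- **Sphere double covers with polynomial fibres**, `n = s + 2`, `x′ = (x₁, …, x_{s+1})`:
`S(r; A, F) = {Σ_{i ≤ s+1} xᵢ² = r, yⱼ = Aⱼ(x′) + yₙ Fⱼ(yₙ, x′) (j ≤ s)}` — the problem side's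
sphere family (`sphereBM_inter_expGraph_nonempty`, p184209) with the Brownawell–Masser datum
specialised to the graph of `A` and `xₙ`-free `F`. [folklore] -/
noncomputable def sphereFibredCover (r : ℂ) (A : Fin (s + 1) → MvPolynomial (Fin (s + 1)) ℂ)
    (F : Fin (s + 1) → MvPolynomial (Fin (s + 2)) ℂ) : Set (Fin (s + 2) ⊕ Fin (s + 2) → ℂ) :=
  polyFibredCover 2 (spherePoly s r) A F

/-- Membership in `S(r; A, F)`. [folklore] -/
theorem mem_sphereFibredCover_iff (r : ℂ) (A : Fin (s + 1) → MvPolynomial (Fin (s + 1)) ℂ)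
    (F : Fin (s + 1) → MvPolynomial (Fin (s + 2)) ℂ) (z : Fin (s + 2) ⊕ Fin (s + 2) → ℂ) :
    z ∈ sphereFibredCover r A F ↔
      ∑ i, z (Sum.inl i) ^ 2 = r ∧
        ∀ j : Fin (s + 1), z (Sum.inr (Fin.castSucc j)) =
          eval (fun i => z (Sum.inl (Fin.castSucc i))) (A j) +
            z (Sum.inr (Fin.last (s + 1))) *
              eval (Fin.cons (z (Sum.inr (Fin.last (s + 1)))) fun i => z (Sum.inl (Fin.castSucc i)))
                (F j) := by
  rw [sphereFibredCover, mem_polyFibredCover_iff]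
  refine and_congr ?_ Iff.rfl
  simp only [spherePoly, map_sub, map_sum, map_pow, eval_C, eval_X]
  rw [Fin.sum_univ_castSucc (f := fun i : Fin (s + 1 + 1) => z (Sum.inl i) ^ 2)]
  constructor
  · intro h
    linear_combination h
  · intro h
    linear_combination h

/-- **The seven hypotheses of `ECCellAperiodic (s + 1)` for every sphere double cover with
polynomial fibres** (`s ≥ 1` or `r ≠ 0`; `τ` injective): the base is irreducible
(`irreducible_cyclicCoverPoly_spherePoly`) and APERIODIC for every `r` (gen 6's
`not_hasIntegerPeriod_sphereBase`). [folklore] -/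
theorem ecCellAperiodic_hypotheses_sphereFibredCover (r : ℂ)
    (A : Fin (s + 1) → MvPolynomial (Fin (s + 1)) ℂ) (F : Fin (s + 1) → MvPolynomial (Fin (s + 2)) ℂ)
    (h : s ≠ 0 ∨ r ≠ 0)
    (hτ : Function.Injective (aeval (pMulSubst A F) :
      MvPolynomial (Fin (s + 2)) ℂ →ₐ[ℂ] MvPolynomial (Fin (s + 2)) ℂ)) :
    IsIrreducibleClosed ℂ (sphereFibredCover r A F) ∧
      (sphereFibredCover r A F ∩ torusLocus ℂ (s + 2)).Nonempty ∧
      IsAddFree ℂ (s + 2) (sphereFibredCover r A F ∩ torusLocus ℂ (s + 2)) ∧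
      IsMulFree ℂ (s + 2) (sphereFibredCover r A F ∩ torusLocus ℂ (s + 2)) ∧
      zariskiDim ℂ (sphereFibredCover r A F) = (s + 2 : ℕ) ∧
      addProjDim ℂ (s + 2) (sphereFibredCover r A F) = (s + 1 : ℕ) ∧
      ¬ HasIntegerPeriod ℂ (projAdd '' (sphereFibredCover r A F ∩ torusLocus ℂ (s + 2))) := by
  have haper : ¬ HasIntegerPeriod ℂ (cyclicCoverBase 2 (spherePoly s r)) := by
    rw [cyclicCoverBase_spherePoly]
    exact not_hasIntegerPeriod_sphereBase s r
  exact ecCellAperiodic_hypotheses_polyFibredCover A F le_rfl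
    (irreducible_cyclicCoverPoly_spherePoly s r h) hτ haper

/-- **`ECCellAperiodic (s + 1)` gives exponential points on every such sphere cover.** [folklore] -/
theorem sphereFibredCover_inter_expGraph_nonempty_of_ecCellAperiodic (hcell : ECCellAperiodic (s + 1))
    (r : ℂ) (A : Fin (s + 1) → MvPolynomial (Fin (s + 1)) ℂ)
    (F : Fin (s + 1) → MvPolynomial (Fin (s + 2)) ℂ) (h : s ≠ 0 ∨ r ≠ 0)
    (hτ : Function.Injective (aeval (pMulSubst A F) :
      MvPolynomial (Fin (s + 2)) ℂ →ₐ[ℂ] MvPolynomial (Fin (s + 2)) ℂ)) :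
    (sphereFibredCover r A F ∩ expGraph ℂ (s + 2)).Nonempty := by
  obtain ⟨h1, h2, h3, h4, h5, h6, h7⟩ := ecCellAperiodic_hypotheses_sphereFibredCover r A F h hτ
  exact hcell _ h1 h2 h3 h4 h5 h6 h7

/-- **System dictionary**: `S(r; A, F) ∩ Γ_exp ≠ ∅ ↔ ∃ x′ t, Σ x′ᵢ² + t² = r ∧
∀ j, e^{xⱼ} = Aⱼ(x′) + e^t Fⱼ(e^t, x′)`. [folklore] -/
theorem sphereFibredCover_inter_expGraph_nonempty_iff (r : ℂ)
    (A : Fin (s + 1) → MvPolynomial (Fin (s + 1)) ℂ) (F : Fin (s + 1) → MvPolynomial (Fin (s + 2)) ℂ) :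
    (sphereFibredCover r A F ∩ expGraph ℂ (s + 2)).Nonempty ↔
      ∃ (x : Fin (s + 1) → ℂ) (t : ℂ), ∑ i, x i ^ 2 + t ^ 2 = r ∧
        ∀ j, Complex.exp (x j) = eval x (A j) +
          Complex.exp t * eval (Fin.cons (Complex.exp t) x : Fin (s + 2) → ℂ) (F j) := by
  rw [sphereFibredCover, polyFibredCover_inter_expGraph_nonempty_iff]
  refine exists_congr fun x => exists_congr fun t => and_congr ?_ Iff.rfl
  simp only [spherePoly, map_sub, map_sum, map_pow, eval_C, eval_X]
  constructor
  · intro h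
    linear_combination h
  · intro h
    linear_combination h

/-- The problem side's sphere set (`sphereBM_inter_expGraph_nonempty`, p184209), VERBATIM, as a
definition with the Brownawell–Masser datum `W` and the fibres `F ∈ ℂ[yₙ, xₙ, x′]` abstract.
[folklore] -/
def sphereBMVariety (r : ℂ) (W : Set (Fin (s + 1) ⊕ Fin (s + 1) → ℂ))
    (F : Fin (s + 1) → MvPolynomial (Fin (s + 1 + 2)) ℂ) : Set (Fin (s + 2) ⊕ Fin (s + 2) → ℂ) :=
  {z : Fin (s + 2) ⊕ Fin (s + 2) → ℂ |
    ∑ i, z (Sum.inl i) ^ 2 = r ∧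
    (Sum.elim (fun j => z (Sum.inl (Fin.castSucc j)))
        (fun j => z (Sum.inr (Fin.castSucc j)) - z (Sum.inr (Fin.last (s + 1))) *
          eval (Fin.cons (z (Sum.inr (Fin.last (s + 1))))
            (Fin.cons (z (Sum.inl (Fin.last (s + 1))))
              (fun i => z (Sum.inl (Fin.castSucc i))) : Fin (s + 2) → ℂ)) (F j)) :
        Fin (s + 1) ⊕ Fin (s + 1) → ℂ) ∈ W}

/-- The graph `{y′ = A(x′)}` of a polynomial self-map as the Brownawell–Masser datum. [folklore] -/
def addGraph (A : Fin (s + 1) → MvPolynomial (Fin (s + 1)) ℂ) : Set (Fin (s + 1) ⊕ Fin (s + 1) → ℂ) :=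
  {w | ∀ j, w (Sum.inr j) = eval (fun i => w (Sum.inl i)) (A j)}

/-- Reindexing `(yₙ, x′) ↦ (yₙ, xₙ, x′)`: `0 ↦ 0`, `i + 1 ↦ i + 2` (= `Fin.succAbove 1`). [folklore] -/
def skipXn (s : ℕ) : Fin (s + 2) → Fin (s + 1 + 2) := fun k =>
  Fin.cases 0 (fun i : Fin (s + 1) => i.succ.succ) k

/-- Dropping the `xₙ` slot. [folklore] -/
theorem cons_cons_comp_skipXn (a b : ℂ) (x : Fin (s + 1) → ℂ) :
    (Fin.cons a (Fin.cons b x : Fin (s + 2) → ℂ) : Fin (s + 1 + 2) → ℂ) ∘ skipXn s =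
      (Fin.cons a x : Fin (s + 2) → ℂ) := by
  funext k
  refine Fin.cases ?_ (fun i => ?_) k
  · simp [skipXn]
  · simp [skipXn]

/-- **The sphere set with `W` = graph of `A` and `xₙ`-free fibres IS `S(r; A, F)`** — so
`sphereBM_inter_expGraph_nonempty` specialised to polynomial data produces exponential points on
CERTIFIED members of `ECCellAperiodic (s + 1)` (`ecCellAperiodic_hypotheses_sphereFibredCover`).
[folklore] -/
theorem sphereBMVariety_addGraph_eq (r : ℂ) (A : Fin (s + 1) → MvPolynomial (Fin (s + 1)) ℂ)
    (F : Fin (s + 1) → MvPolynomial (Fin (s + 2)) ℂ) :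
    sphereBMVariety r (addGraph A) (fun j => rename (skipXn s) (F j)) = sphereFibredCover r A F := by
  ext z
  rw [mem_sphereFibredCover_iff]
  simp only [sphereBMVariety, addGraph, Set.mem_setOf_eq, Sum.elim_inl, Sum.elim_inr, eval_rename,
    cons_cons_comp_skipXn]
  refine and_congr_right fun _ => forall_congr' fun j => ?_
  rw [sub_eq_iff_eq_add]

end SphereCovers

end Literature.ModelTheory.Zilber
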